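import Literature.Analysis.Complex.CarlemanTract
import HarnessLib

/-!
# Carleman's convexity method, II: the dichotomy lemma of de Branges' ordering theorem

The analytic heart of the proof of the ordering theorem for de Branges subspaces
(L. de Branges 1968, Thm. 35; R. Romanov, *Canonical systems and de Branges spaces*,
arXiv:1408.6022, Thm. 12 with proof in Appendix III) is Romanov's Proposition 26: two entire
functions of minimal exponential type with `min(|ξ₁(z)|, |ξ₂(z)|) ≤ c/|Im z|` cannot both be
non-zero. We prove it for entire functions of growth `O(exp (B √|z|))` (order `≤ 1/2`, the case of
the de Branges spaces of Kreĭn strings), following Romanov's proof via Carleman's differential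
inequality (Lemma 27) in the coordinates `s = log r`:

* A. a Poincaré inequality `4 ∫ u² ≤ a² ∫ u'²` for periodic `u` with a zero, `a` the measure of
  `{u ≠ 0}` in a period (distance to the zero set + erosion bound + layer cake; the crude constant
  `4` replaces Romanov's `π²` and suffices below order `1`);
* B. `|{θ ∈ (0, 2π] : |sin θ| < ε}| ≤ 2πε`;
* C. elementary convexity/growth lemmas and the final "two rates" contradiction;
* D–F. the lifted function `Ξ = ξ ∘ exp`, growth of `V = ∫ U²` and `M = ∫ U`, the Phragmén–Lindelöf
  step for the case of a constant, and unboundedness of `V` for non-constant `ξ` (via convexity of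
  the circular means `M` and the identity theorem);
* G. the rate inequality `V''/V' ≥ 4/a` (AM–GM from `V'' ≥ V'²/(2V) + 2∫U_θ²`), the overlap bound
  `a₁ + a₂ ≤ 2π + 2π e^{-s-1}`, and the dichotomy `eq_zero_or_eq_zero_of_min_norm_le`.

Everything here is PROVED; no named facts.

## References

* R. Romanov, arXiv:1408.6022, Appendix III (Proposition 26, Lemma 27).
* L. de Branges, *Hilbert spaces of entire functions* (1968), Theorem 35.
-/

open Real Set Filter Topology MeasureTheory intervalIntegral

noncomputable section

namespace Literature.Analysis.Complex

namespace CarlemanTract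

/-! ### A. A Poincaré inequality with the measure of the positivity set

For a `T`-periodic `C¹` function `u` with a zero, `4 ∫₀ᵀ u² ≤ a² ∫₀ᵀ u'²` where `a` is the
measure of `{u ≠ 0}` in a period (Romanov uses the sharp constant `π²` on each component of the
positivity set, via the first Dirichlet eigenvalue; the constant `4`, obtained from the distance to
the zero set and the layer-cake formula, suffices for functions of order `< 1`). -/

section Poincare

/-- Cauchy–Schwarz for interval integrals of continuous functions:
`(∫ₐᵇ f)² ≤ (b - a) ∫ₐᵇ f²`. [folklore] -/
theorem sq_integral_le_mul_integral_sq {f : ℝ → ℝ} {a b : ℝ} (hab : a ≤ b) (hf : Continuous f) :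
    (∫ x in a..b, f x) ^ 2 ≤ (b - a) * ∫ x in a..b, f x ^ 2 := by
  have hi : IntervalIntegrable f volume a b := hf.intervalIntegrable _ _
  have hi2 : IntervalIntegrable (fun x => f x ^ 2) volume a b := (hf.pow 2).intervalIntegrable _ _
  have hq : ∀ t : ℝ, 0 ≤ (b - a) * (t * t) + (2 * ∫ x in a..b, f x) * t + ∫ x in a..b, f x ^ 2 := by
    intro t
    have : (b - a) * (t * t) + (2 * ∫ x in a..b, f x) * t + ∫ x in a..b, f x ^ 2 =
        ∫ x in a..b, (t + f x) ^ 2 := by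
      rw [← intervalIntegral.integral_const_mul, ← intervalIntegral.integral_mul_const]
      have h1 : (b - a) * (t * t) = ∫ x in a..b, t * t := by simp; ring
      rw [h1, ← intervalIntegral.integral_add intervalIntegrable_const (hi.const_mul _ |>.mul_const _),
        ← intervalIntegral.integral_add (intervalIntegrable_const.add (hi.const_mul _ |>.mul_const _)) hi2]
      refine intervalIntegral.integral_congr fun x _ => ?_
      ring
    rw [this]
    exact intervalIntegral.integral_nonneg hab fun x _ => sq_nonneg _
  have hd := discrim_le_zero hq
  rw [discrim] at hd
  nlinarith

variable {u u' : ℝ → ℝ} {T : ℝ}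

/-- The zero set of `u`. [folklore] -/
def zeroSet (u : ℝ → ℝ) : Set ℝ := {θ | u θ = 0}

/-- Distance to the zero set. [folklore] -/
def zeroDist (u : ℝ → ℝ) (θ : ℝ) : ℝ := Metric.infDist θ (zeroSet u)

/-- Auxiliary step of the Carleman dichotomy (see the section header). [folklore] -/
theorem isClosed_zeroSet (hu : Continuous u) : IsClosed (zeroSet u) :=
  isClosed_eq hu continuous_const

/-- Auxiliary step of the Carleman dichotomy (see the section header). [folklore] -/
theorem continuous_zeroDist (u : ℝ → ℝ) : Continuous (zeroDist u) :=
  Metric.continuous_infDist_pt _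

/-- Auxiliary step of the Carleman dichotomy (see the section header). [folklore] -/
theorem zeroDist_nonneg (u : ℝ → ℝ) (θ : ℝ) : 0 ≤ zeroDist u θ := Metric.infDist_nonneg

/-- `|d(θ) - d(θ')| ≤ |θ - θ'|`. [folklore] -/
theorem zeroDist_le_add_dist (u : ℝ → ℝ) (θ θ' : ℝ) : zeroDist u θ ≤ zeroDist u θ' + dist θ θ' :=
  Metric.infDist_le_infDist_add_dist

/-- Auxiliary step of the Carleman dichotomy (see the section header). [folklore] -/
theorem zeroDist_eq_zero_iff (hu : Continuous u) (hz : (zeroSet u).Nonempty) {θ : ℝ} :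
    zeroDist u θ = 0 ↔ u θ = 0 := by
  rw [zeroDist, ← (isClosed_zeroSet hu).mem_iff_infDist_zero hz]; rfl

/-- Auxiliary step of the Carleman dichotomy (see the section header). [folklore] -/
theorem zeroDist_pos_iff (hu : Continuous u) (hz : (zeroSet u).Nonempty) {θ : ℝ} :
    0 < zeroDist u θ ↔ u θ ≠ 0 := by
  rw [← not_iff_not, not_lt, Ne, not_not, ← zeroDist_eq_zero_iff hu hz]
  exact ⟨fun h => le_antisymm h (zeroDist_nonneg u θ), fun h => h.le⟩

/-- Periodicity of the zero set: `d(θ) ≤ T/2` (there is a zero within half a period). [folklore] -/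
theorem zeroDist_le_half_period (hper : Function.Periodic u T) (hT : 0 < T) {θ₀ : ℝ}
    (h0 : u θ₀ = 0) (θ : ℝ) : zeroDist u θ ≤ T / 2 := by
  -- the zero `θ₀ + n T` nearest to `θ`
  obtain ⟨n, hn⟩ : ∃ n : ℤ, |θ - (θ₀ + n * T)| ≤ T / 2 := by
    refine ⟨round ((θ - θ₀) / T), ?_⟩
    have h := abs_sub_round ((θ - θ₀) / T)
    have : θ - (θ₀ + (round ((θ - θ₀) / T) : ℝ) * T) = ((θ - θ₀) / T - round ((θ - θ₀) / T)) * T := by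
      field_simp
      ring
    rw [this, abs_mul, abs_of_pos hT]
    calc |(θ - θ₀) / T - ↑(round ((θ - θ₀) / T))| * T ≤ 1 / 2 * T :=
          mul_le_mul_of_nonneg_right h hT.le
      _ = T / 2 := by ring
  have hzero : u (θ₀ + n * T) = 0 := by
    rw [hper.int_mul n θ₀]
    exact h0
  calc zeroDist u θ ≤ dist θ (θ₀ + n * T) := Metric.infDist_le_dist_of_mem hzero
    _ = |θ - (θ₀ + n * T)| := Real.dist_eq _ _
    _ ≤ T / 2 := hn


/-- The derivative of a periodic function is periodic. [folklore] -/
theorem periodic_deriv_of_periodic (hper : Function.Periodic u T) (hu : ∀ θ, HasDerivAt u (u' θ) θ) :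
    Function.Periodic u' T := by
  intro θ
  have h1 : HasDerivAt (fun x => u (x + T)) (u' (θ + T)) θ := HasDerivAt.comp_add_const θ T (hu (θ + T))
  have h2 : (fun x => u (x + T)) = u := funext hper
  rw [h2] at h1
  exact h1.unique (hu θ)

/-- **Pointwise bound**: `u(θ)² ≤ d(θ) ∫₀ᵀ u'²`, `d` the distance to the zero set. [folklore] -/
theorem sq_le_zeroDist_mul (hper : Function.Periodic u T) (hT : 0 < T)
    (hu : ∀ θ, HasDerivAt u (u' θ) θ) (hu'c : Continuous u') {θ₀ : ℝ} (h0 : u θ₀ = 0) (θ : ℝ) :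
    u θ ^ 2 ≤ zeroDist u θ * ∫ x in (0 : ℝ)..T, u' x ^ 2 := by
  have huc : Continuous u := continuous_iff_continuousAt.2 fun x => (hu x).continuousAt
  have hZc : IsClosed (zeroSet u) := isClosed_zeroSet huc
  have hZn : (zeroSet u).Nonempty := ⟨θ₀, h0⟩
  obtain ⟨t₀, ht₀Z, ht₀⟩ := hZc.exists_infDist_eq_dist hZn θ
  have ht₀0 : u t₀ = 0 := ht₀Z
  have hd : zeroDist u θ = |θ - t₀| := by rw [zeroDist, ht₀, Real.dist_eq]
  have hper' : Function.Periodic (fun x => u' x ^ 2) T := fun x => by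
    simp only [periodic_deriv_of_periodic hper hu x]
  -- energy over a period, centred at `θ`
  set E : ℝ := ∫ x in (0 : ℝ)..T, u' x ^ 2 with hE
  have hEeq : ∫ x in (θ - T / 2)..(θ - T / 2 + T), u' x ^ 2 = E := by
    rw [hE, hper'.intervalIntegral_add_eq (θ - T / 2) 0, zero_add]
  have hi2 : ∀ a b : ℝ, IntervalIntegrable (fun x => u' x ^ 2) volume a b := fun a b =>
    (hu'c.pow 2).intervalIntegrable _ _
  have hnn : ∀ a b : ℝ, 0 ≤ᵐ[volume.restrict (Ioc a b)] fun x => u' x ^ 2 := fun a b =>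
    Filter.Eventually.of_forall fun x => sq_nonneg _
  have hhalf : |θ - t₀| ≤ T / 2 := by rw [← hd]; exact zeroDist_le_half_period hper hT h0 θ
  -- FTC
  have hftc : u θ = ∫ x in t₀..θ, u' x := by
    rw [intervalIntegral.integral_eq_sub_of_hasDerivAt (fun x _ => hu x) (hu'c.intervalIntegrable _ _),
      ht₀0, sub_zero]
  rcases le_or_gt t₀ θ with hle | hlt
  · -- `t₀ ≤ θ`
    have hcs := sq_integral_le_mul_integral_sq hle hu'c
    have hmono : ∫ x in t₀..θ, u' x ^ 2 ≤ E := by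
      rw [← hEeq]
      refine intervalIntegral.integral_mono_interval ?_ hle ?_ (hnn _ _) (hi2 _ _)
      · rw [abs_of_nonneg (sub_nonneg.2 hle)] at hhalf; linarith
      · rw [abs_of_nonneg (sub_nonneg.2 hle)] at hhalf; linarith
    calc u θ ^ 2 = (∫ x in t₀..θ, u' x) ^ 2 := by rw [← hftc]
      _ ≤ (θ - t₀) * ∫ x in t₀..θ, u' x ^ 2 := hcs
      _ ≤ (θ - t₀) * E := mul_le_mul_of_nonneg_left hmono (sub_nonneg.2 hle)
      _ = zeroDist u θ * E := by rw [hd, abs_of_nonneg (sub_nonneg.2 hle)]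
  · -- `θ < t₀`
    have hcs := sq_integral_le_mul_integral_sq hlt.le hu'c
    have hmono : ∫ x in θ..t₀, u' x ^ 2 ≤ E := by
      rw [← hEeq]
      refine intervalIntegral.integral_mono_interval ?_ hlt.le ?_ (hnn _ _) (hi2 _ _)
      · linarith
      · rw [abs_of_neg (sub_neg.2 hlt)] at hhalf; linarith
    calc u θ ^ 2 = (∫ x in θ..t₀, u' x) ^ 2 := by
          rw [hftc, intervalIntegral.integral_symm, neg_sq]
      _ ≤ (t₀ - θ) * ∫ x in θ..t₀, u' x ^ 2 := hcs
      _ ≤ (t₀ - θ) * E := mul_le_mul_of_nonneg_left hmono (sub_nonneg.2 hlt.le)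
      _ = zeroDist u θ * E := by rw [hd, abs_of_neg (sub_neg.2 hlt)]; ring


/-- The positivity set `{u ≠ 0}`. [folklore] -/
def posSet (u : ℝ → ℝ) : Set ℝ := {θ | u θ ≠ 0}

/-- Auxiliary step of the Carleman dichotomy (see the section header). [folklore] -/
theorem isOpen_posSet (hu : Continuous u) : IsOpen (posSet u) :=
  isOpen_ne_fun hu continuous_const

/-- **Erosion bound.** In a period window `W = (θ*, θ* + T]` starting at a zero `θ*` of `u`, the
set where the distance to the zero set exceeds `r` has measure at most `|{u ≠ 0} ∩ W| - 2r`
(unless it is empty). [folklore] -/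
theorem volume_real_lt_zeroDist_add_le (hper : Function.Periodic u T)
    (huc : Continuous u) {θs : ℝ} (hs : u θs = 0) {r : ℝ} (hr : 0 < r)
    (hne : {θ | θ ∈ Ioc θs (θs + T) ∧ r < zeroDist u θ}.Nonempty) :
    volume.real {θ | θ ∈ Ioc θs (θs + T) ∧ r < zeroDist u θ} + 2 * r ≤
      volume.real (posSet u ∩ Ioc θs (θs + T)) := by
  set W : Set ℝ := Ioc θs (θs + T) with hW
  set S : Set ℝ := {θ | θ ∈ W ∧ r < zeroDist u θ} with hS
  have hZn : (zeroSet u).Nonempty := ⟨θs, hs⟩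
  have hsT : u (θs + T) = 0 := by rw [hper θs]; exact hs
  -- elements of `S` lie in `(θs + r, θs + T - r)`
  have hlow : ∀ θ ∈ S, θs + r < θ := by
    intro θ hθ
    have h1 : zeroDist u θ ≤ dist θ θs := Metric.infDist_le_dist_of_mem (show θs ∈ zeroSet u from hs)
    rw [Real.dist_eq, abs_of_pos (sub_pos.2 hθ.1.1)] at h1
    linarith [hθ.2]
  have hupp : ∀ θ ∈ S, θ < θs + T - r := by
    intro θ hθ
    have h1 : zeroDist u θ ≤ dist θ (θs + T) :=
      Metric.infDist_le_dist_of_mem (show θs + T ∈ zeroSet u from hsT)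
    rw [Real.dist_eq, abs_of_nonpos (sub_nonpos.2 hθ.1.2)] at h1
    linarith [hθ.2]
  have hbb : BddBelow S := ⟨θs + r, fun θ hθ => (hlow θ hθ).le⟩
  have hba : BddAbove S := ⟨θs + T - r, fun θ hθ => (hupp θ hθ).le⟩
  set m := sInf S with hm
  set M := sSup S with hM
  have hm_low : θs + r ≤ m := le_csInf hne fun θ hθ => (hlow θ hθ).le
  have hM_upp : M ≤ θs + T - r := csSup_le hne fun θ hθ => (hupp θ hθ).le
  have hmM : m ≤ M := (csInf_le hbb hne.some_mem).trans (le_csSup hba hne.some_mem)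
  -- `d ≥ r` at `m` and `M`
  have hclosed : IsClosed {θ : ℝ | r ≤ zeroDist u θ} := isClosed_le continuous_const (continuous_zeroDist u)
  have hSsub : S ⊆ {θ : ℝ | r ≤ zeroDist u θ} := fun θ hθ => hθ.2.le
  have hdm : r ≤ zeroDist u m := hclosed.closure_subset_iff.2 hSsub (csInf_mem_closure hne hbb)
  have hdM : r ≤ zeroDist u M := hclosed.closure_subset_iff.2 hSsub (csSup_mem_closure hne hba)
  -- the two buffer intervals
  set I₁ : Set ℝ := Ioo (m - r) m with hI₁
  set I₂ : Set ℝ := Ioo M (M + r) with hI₂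
  have hI₁sub : I₁ ⊆ posSet u ∩ W := by
    intro θ hθ
    refine ⟨?_, ?_, ?_⟩
    · show u θ ≠ 0
      rw [← zeroDist_pos_iff huc hZn]
      have h1 := zeroDist_le_add_dist u m θ
      rw [Real.dist_eq, abs_of_pos (sub_pos.2 hθ.2)] at h1
      linarith [hθ.1]
    · linarith [hθ.1]
    · linarith [hθ.2]
  have hI₂sub : I₂ ⊆ posSet u ∩ W := by
    intro θ hθ
    refine ⟨?_, ?_, ?_⟩
    · show u θ ≠ 0
      rw [← zeroDist_pos_iff huc hZn]
      have h1 := zeroDist_le_add_dist u M θ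
      rw [Real.dist_eq, abs_of_neg (sub_neg.2 hθ.1)] at h1
      linarith [hθ.2]
    · linarith [hθ.1]
    · linarith [hθ.2]
  have hSsubW : S ⊆ posSet u ∩ W := by
    intro θ hθ
    exact ⟨(zeroDist_pos_iff huc hZn).1 (hr.trans hθ.2), hθ.1⟩
  have hSIcc : S ⊆ Icc m M := fun θ hθ => ⟨csInf_le hbb hθ, le_csSup hba hθ⟩
  -- disjointness
  have hd12 : Disjoint I₁ I₂ := by
    rw [Set.disjoint_left]; intro θ h1 h2; exact absurd (h1.2.trans_le hmM) (not_lt.2 h2.1.le)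
  have hd1S : Disjoint I₁ S := by
    rw [Set.disjoint_left]; intro θ h1 h2; exact absurd h1.2 (not_lt.2 (hSIcc h2).1)
  have hd2S : Disjoint I₂ S := by
    rw [Set.disjoint_left]; intro θ h1 h2; exact absurd h1.1 (not_lt.2 (hSIcc h2).2)
  -- measurability
  have hSmeas : MeasurableSet S := by
    have : S = W ∩ (zeroDist u) ⁻¹' Ioi r := by ext θ; simp [hS, hW]
    rw [this]
    exact measurableSet_Ioc.inter ((continuous_zeroDist u).measurable measurableSet_Ioi)
  have hfin : volume (posSet u ∩ W) ≠ ⊤ :=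
    ((measure_mono Set.inter_subset_right).trans_lt measure_Ioc_lt_top).ne
  have h1fin : volume I₁ ≠ ⊤ := measure_Ioo_lt_top.ne
  have h2fin : volume I₂ ≠ ⊤ := measure_Ioo_lt_top.ne
  have hSfin : volume S ≠ ⊤ := ((measure_mono hSsubW).trans_lt (lt_top_iff_ne_top.2 hfin)).ne
  have h12fin : volume (I₁ ∪ I₂) ≠ ⊤ :=
    ((measure_union_le _ _).trans_lt (ENNReal.add_lt_top.2 ⟨lt_top_iff_ne_top.2 h1fin,
      lt_top_iff_ne_top.2 h2fin⟩)).ne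
  have hunion : volume.real (I₁ ∪ I₂ ∪ S) = r + r + volume.real S := by
    rw [measureReal_union (hd1S.union_left hd2S) hSmeas h12fin hSfin,
      measureReal_union hd12 measurableSet_Ioo h1fin h2fin, hI₁, hI₂,
      Real.volume_real_Ioo_of_le (by linarith), Real.volume_real_Ioo_of_le (by linarith)]
    ring
  have hsub : I₁ ∪ I₂ ∪ S ⊆ posSet u ∩ W := Set.union_subset (Set.union_subset hI₁sub hI₂sub) hSsubW
  have := measureReal_mono hsub hfin
  rw [hunion] at this
  linarith

/-- `∫₀^{a/2} (a - 2t) dt = a²/4`. [folklore] -/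
theorem integral_sub_two_mul {a : ℝ} :
    ∫ t in (0 : ℝ)..a / 2, (a - 2 * t) = a ^ 2 / 4 := by
  have h1 : ∫ t in (0 : ℝ)..a / 2, (a - 2 * t) = (∫ t in (0 : ℝ)..a / 2, a) - ∫ t in (0 : ℝ)..a / 2, 2 * t :=
    intervalIntegral.integral_sub intervalIntegrable_const
      (Continuous.intervalIntegrable (by fun_prop) _ _)
  rw [h1, intervalIntegral.integral_const, intervalIntegral.integral_const_mul, integral_id]
  simp
  ring

/-- **Layer cake**: in a period window, `∫_W d ≤ a²/4`, `a = |{u ≠ 0} ∩ W|`. [folklore] -/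
theorem integral_zeroDist_le (hper : Function.Periodic u T) (huc : Continuous u)
    {θs : ℝ} (hs : u θs = 0) :
    ∫ θ in Ioc θs (θs + T), zeroDist u θ ≤
      (volume.real (posSet u ∩ Ioc θs (θs + T))) ^ 2 / 4 := by
  set W : Set ℝ := Ioc θs (θs + T) with hW
  set a : ℝ := volume.real (posSet u ∩ W) with ha
  have ha0 : 0 ≤ a := measureReal_nonneg
  -- layer cake for the Lebesgue integral
  have key := lintegral_eq_lintegral_meas_lt (volume.restrict W) (f := zeroDist u)
    (Filter.Eventually.of_forall fun θ => zeroDist_nonneg u θ)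
    (continuous_zeroDist u).measurable.aemeasurable
  -- bound for the superlevel sets
  have hlevel : ∀ t : ℝ, 0 < t →
      (volume.restrict W) {θ : ℝ | t < zeroDist u θ} ≤ ENNReal.ofReal (max (a - 2 * t) 0) := by
    intro t ht
    have hmeas : MeasurableSet {θ : ℝ | t < zeroDist u θ} :=
      (continuous_zeroDist u).measurable measurableSet_Ioi
    rw [Measure.restrict_apply hmeas]
    have hset : {θ : ℝ | t < zeroDist u θ} ∩ W = {θ | θ ∈ W ∧ t < zeroDist u θ} := by
      ext θ; simp only [Set.mem_inter_iff, Set.mem_setOf_eq]; tauto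
    rw [hset]
    rcases Set.eq_empty_or_nonempty {θ | θ ∈ W ∧ t < zeroDist u θ} with hemp | hne
    · rw [hemp, measure_empty]; exact bot_le
    · have hb := volume_real_lt_zeroDist_add_le hper huc hs ht hne
      have hfinS : volume {θ | θ ∈ W ∧ t < zeroDist u θ} ≠ ⊤ :=
        ((measure_mono fun θ hθ => hθ.1).trans_lt measure_Ioc_lt_top).ne
      rw [← ENNReal.ofReal_toReal hfinS]
      refine ENNReal.ofReal_le_ofReal (le_trans ?_ (le_max_left _ _))
      have : volume.real {θ | θ ∈ W ∧ t < zeroDist u θ} = (volume {θ | θ ∈ W ∧ t < zeroDist u θ}).toReal := rfl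
      linarith
  -- integrate the bound
  have hunion : Ioc 0 (a / 2) ∪ Ioi (a / 2) = Ioi (0 : ℝ) := Ioc_union_Ioi_eq_Ioi (by linarith)
  have hdisj : Disjoint (Ioc (0 : ℝ) (a / 2)) (Ioi (a / 2)) :=
    Set.disjoint_left.2 fun t h1 h2 => (not_lt.2 h1.2) h2
  have hI1 : IntegrableOn (fun t : ℝ => max (a - 2 * t) 0) (Ioc 0 (a / 2)) volume :=
    (Continuous.max (by fun_prop) continuous_const).integrableOn_Ioc
  have hI2 : IntegrableOn (fun t : ℝ => max (a - 2 * t) 0) (Ioi (a / 2)) volume := by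
    refine IntegrableOn.congr_fun (f := fun _ => (0 : ℝ)) integrableOn_zero (fun t ht => ?_)
      measurableSet_Ioi
    exact (max_eq_right (by simp only [Set.mem_Ioi] at ht; linarith)).symm
  have hg_int : IntegrableOn (fun t : ℝ => max (a - 2 * t) 0) (Ioi 0) volume := by
    rw [← hunion]; exact hI1.union hI2
  have hg_val : ∫ t in Ioi 0, max (a - 2 * t) 0 = a ^ 2 / 4 := by
    have h2 : ∫ t in Ioi (a / 2), max (a - 2 * t) 0 = 0 := by
      refine setIntegral_eq_zero_of_forall_eq_zero fun t ht => ?_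
      exact max_eq_right (by simp only [Set.mem_Ioi] at ht; linarith)
    have h1 : ∫ t in Ioc 0 (a / 2), max (a - 2 * t) 0 = ∫ t in (0 : ℝ)..a / 2, (a - 2 * t) := by
      rw [intervalIntegral.integral_of_le (by linarith)]
      refine setIntegral_congr_fun measurableSet_Ioc fun t ht => ?_
      exact max_eq_left (by simp only [Set.mem_Ioc] at ht; linarith)
    calc ∫ t in Ioi 0, max (a - 2 * t) 0
        = ∫ t in Ioc 0 (a / 2) ∪ Ioi (a / 2), max (a - 2 * t) 0 := by rw [hunion]
      _ = (∫ t in Ioc 0 (a / 2), max (a - 2 * t) 0) + ∫ t in Ioi (a / 2), max (a - 2 * t) 0 :=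
          setIntegral_union hdisj measurableSet_Ioi hI1 hI2
      _ = a ^ 2 / 4 := by rw [h2, add_zero, h1, integral_sub_two_mul]
  have hbound : ∫⁻ t in Ioi 0, (volume.restrict W) {θ : ℝ | t < zeroDist u θ} ≤
      ENNReal.ofReal (a ^ 2 / 4) := by
    calc ∫⁻ t in Ioi 0, (volume.restrict W) {θ : ℝ | t < zeroDist u θ}
        ≤ ∫⁻ t in Ioi 0, ENNReal.ofReal (max (a - 2 * t) 0) :=
          setLIntegral_mono' measurableSet_Ioi fun t ht => hlevel t ht
      _ = ENNReal.ofReal (∫ t in Ioi 0, max (a - 2 * t) 0) := by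
          rw [ofReal_integral_eq_lintegral_ofReal hg_int
            (Filter.Eventually.of_forall fun t => le_max_right _ _)]
      _ = ENNReal.ofReal (a ^ 2 / 4) := by rw [hg_val]
  -- back to the Bochner integral
  have hint : IntegrableOn (zeroDist u) W volume := (continuous_zeroDist u).integrableOn_Ioc
  rw [integral_eq_lintegral_of_nonneg_ae (Filter.Eventually.of_forall fun θ => zeroDist_nonneg u θ)
    hint.aestronglyMeasurable, key]
  have hfin : ∫⁻ t in Ioi 0, (volume.restrict W) {θ : ℝ | t < zeroDist u θ} ≠ ⊤ :=
    (hbound.trans_lt ENNReal.ofReal_lt_top).ne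
  calc (∫⁻ t in Ioi 0, (volume.restrict W) {θ : ℝ | t < zeroDist u θ}).toReal
      ≤ (ENNReal.ofReal (a ^ 2 / 4)).toReal := ENNReal.toReal_mono ENNReal.ofReal_ne_top hbound
    _ = a ^ 2 / 4 := ENNReal.toReal_ofReal (by positivity)


/-- The measure of the positivity set in a period window does not depend on the window. [folklore] -/
theorem volume_real_posSet_inter_Ioc (hper : Function.Periodic u T) (hT : 0 < T) (huc : Continuous u)
    (t : ℝ) : volume.real (posSet u ∩ Ioc t (t + T)) = volume.real (posSet u ∩ Ioc 0 T) := by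
  have hO : MeasurableSet (posSet u) := (isOpen_posSet huc).measurableSet
  have hind : Function.Periodic ((posSet u).indicator fun _ => (1 : ℝ)) T := by
    intro x
    have : x + T ∈ posSet u ↔ x ∈ posSet u := by simp [posSet, hper x]
    by_cases hx : x ∈ posSet u
    · rw [Set.indicator_of_mem hx, Set.indicator_of_mem (this.2 hx)]
    · rw [Set.indicator_of_notMem hx, Set.indicator_of_notMem (fun h => hx (this.1 h))]
  have hrepr : ∀ s : ℝ, volume.real (posSet u ∩ Ioc s (s + T)) =
      ∫ x in s..s + T, (posSet u).indicator (fun _ => (1 : ℝ)) x := by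
    intro s
    rw [intervalIntegral.integral_of_le (by linarith), MeasureTheory.integral_indicator hO,
      setIntegral_const, smul_eq_mul, mul_one, measureReal_restrict_apply hO]
  have h0 := hrepr 0
  rw [zero_add] at h0
  rw [hrepr, h0, hind.intervalIntegral_add_eq t 0, zero_add]

/-- **Poincaré inequality with the measure of the positivity set.** For a `T`-periodic `C¹`
function `u` having a zero, `4 ∫₀ᵀ u² ≤ a² ∫₀ᵀ u'²`, where `a = |{u ≠ 0} ∩ (0, T]|`.
(Romanov, proof of Lemma 27, inequality (Dirichlet), with the constant `(|I|/π)²` per component;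
here with the cruder constant `a²/4`.) [cite: Romanov2014, App. III proof of Lemma 27] -/
theorem four_mul_integral_sq_le (hper : Function.Periodic u T) (hT : 0 < T)
    (hu : ∀ θ, HasDerivAt u (u' θ) θ) (hu'c : Continuous u') {θ₀ : ℝ} (h0 : u θ₀ = 0) :
    4 * ∫ x in (0 : ℝ)..T, u x ^ 2 ≤
      (volume.real (posSet u ∩ Ioc 0 T)) ^ 2 * ∫ x in (0 : ℝ)..T, u' x ^ 2 := by
  have huc : Continuous u := continuous_iff_continuousAt.2 fun x => (hu x).continuousAt
  set W : Set ℝ := Ioc θ₀ (θ₀ + T) with hW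
  set E : ℝ := ∫ x in (0 : ℝ)..T, u' x ^ 2 with hE
  have hE0 : 0 ≤ E := intervalIntegral.integral_nonneg hT.le fun x _ => sq_nonneg _
  have ha : volume.real (posSet u ∩ W) = volume.real (posSet u ∩ Ioc 0 T) :=
    volume_real_posSet_inter_Ioc hper hT huc θ₀
  -- move the integral of `u²` to the window `W`
  have hper2 : Function.Periodic (fun x => u x ^ 2) T := fun x => by simp only [hper x]
  have h1 : ∫ x in (0 : ℝ)..T, u x ^ 2 = ∫ x in W, u x ^ 2 := by
    rw [← intervalIntegral.integral_of_le (by linarith : θ₀ ≤ θ₀ + T),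
      hper2.intervalIntegral_add_eq θ₀ 0, zero_add]
  -- integrate the pointwise bound over `W`
  have h2 : ∫ x in W, u x ^ 2 ≤ ∫ x in W, zeroDist u x * E := by
    refine setIntegral_mono_on ((huc.pow 2).integrableOn_Ioc)
      (((continuous_zeroDist u).mul continuous_const).integrableOn_Ioc) measurableSet_Ioc ?_
    intro x _
    exact sq_le_zeroDist_mul hper hT hu hu'c h0 x
  have h3 : ∫ x in W, zeroDist u x * E = E * ∫ x in W, zeroDist u x := by
    rw [MeasureTheory.integral_mul_const]; ring
  have h4 := integral_zeroDist_le hper huc h0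
  rw [h1, ← ha]
  calc 4 * ∫ x in W, u x ^ 2 ≤ 4 * (E * ∫ x in W, zeroDist u x) := by nlinarith
    _ ≤ 4 * (E * ((volume.real (posSet u ∩ W)) ^ 2 / 4)) := by
        have := mul_le_mul_of_nonneg_left h4 hE0
        linarith
    _ = (volume.real (posSet u ∩ W)) ^ 2 * E := by ring

end Poincare


/-! ### B. The measure of `{θ : |sin θ| < ε}` in a period -/

section SinSmall

/-- Jordan-type lower bound: on `(0, 2π]` outside the `c`-neighbourhood of `{0, π, 2π}`,
`|sin θ| ≥ (2/π) c` (for `0 ≤ c ≤ π/2`). [folklore] -/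
theorem abs_sin_ge_of_far {θ c : ℝ} (hc : 0 ≤ c) (h0 : c ≤ θ) (h1 : c ≤ |θ - π|)
    (h2 : θ ≤ 2 * π - c) : 2 / π * c ≤ |Real.sin θ| := by
  rcases le_or_gt θ (π / 2) with hq1 | hq1
  · -- `θ ∈ [c, π/2]`
    have hs : 2 / π * θ ≤ Real.sin θ := Real.mul_le_sin (hc.trans h0) hq1
    have : 2 / π * c ≤ 2 / π * θ := mul_le_mul_of_nonneg_left h0 (by positivity)
    exact this.trans (hs.trans (le_abs_self _))
  rcases le_or_gt θ π with hq2 | hq2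
  · -- `θ ∈ (π/2, π]`: `sin θ = sin (π - θ)`
    have hpt : c ≤ π - θ := by
      rw [abs_of_nonpos (by linarith)] at h1; linarith
    have hs : 2 / π * (π - θ) ≤ Real.sin (π - θ) := Real.mul_le_sin (by linarith) (by linarith)
    rw [Real.sin_pi_sub] at hs
    have : 2 / π * c ≤ 2 / π * (π - θ) := mul_le_mul_of_nonneg_left hpt (by positivity)
    exact this.trans (hs.trans (le_abs_self _))
  rcases le_or_gt θ (3 * π / 2) with hq3 | hq3
  · -- `θ ∈ (π, 3π/2]`: `|sin θ| = sin (θ - π)`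
    have hpt : c ≤ θ - π := by
      rw [abs_of_pos (by linarith)] at h1; exact h1
    have hs : 2 / π * (θ - π) ≤ Real.sin (θ - π) := Real.mul_le_sin (by linarith) (by linarith)
    rw [Real.sin_sub_pi] at hs
    have : 2 / π * c ≤ 2 / π * (θ - π) := mul_le_mul_of_nonneg_left hpt (by positivity)
    exact this.trans (hs.trans (neg_le_abs _))
  · -- `θ ∈ (3π/2, 2π - c]`: `|sin θ| = sin (2π - θ)`
    have hpt : c ≤ 2 * π - θ := by linarith
    have hs : 2 / π * (2 * π - θ) ≤ Real.sin (2 * π - θ) := Real.mul_le_sin (by linarith) (by linarith)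
    rw [Real.sin_two_pi_sub] at hs
    have : 2 / π * c ≤ 2 / π * (2 * π - θ) := mul_le_mul_of_nonneg_left hpt (by positivity)
    exact this.trans (hs.trans (neg_le_abs _))

/-- `|{θ ∈ (0, 2π] : |sin θ| < ε}| ≤ 2π ε`. [folklore] -/
theorem volume_real_abs_sin_lt_le {ε : ℝ} (hε : 0 ≤ ε) :
    volume.real {θ : ℝ | θ ∈ Ioc 0 (2 * π) ∧ |Real.sin θ| < ε} ≤ 2 * π * ε := by
  rcases le_or_gt 1 ε with hε1 | hε1
  · -- trivial for `ε ≥ 1`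
    calc volume.real {θ : ℝ | θ ∈ Ioc 0 (2 * π) ∧ |Real.sin θ| < ε}
        ≤ volume.real (Ioc 0 (2 * π)) := measureReal_mono (fun θ hθ => hθ.1) measure_Ioc_lt_top.ne
      _ = 2 * π := by rw [Real.volume_real_Ioc_of_le (by positivity)]; ring
      _ ≤ 2 * π * ε := by nlinarith [Real.pi_pos]
  set c : ℝ := π / 2 * ε with hc
  have hc0 : 0 ≤ c := by positivity
  have hcle : c ≤ π / 2 := by
    have := mul_le_mul_of_nonneg_left hε1.le (by positivity : 0 ≤ π / 2)
    simpa [hc] using this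
  -- cover by three intervals of total length `4c = 2πε`
  have hcover : {θ : ℝ | θ ∈ Ioc 0 (2 * π) ∧ |Real.sin θ| < ε} ⊆
      Ioo 0 c ∪ Ioo (π - c) (π + c) ∪ Ioc (2 * π - c) (2 * π) := by
    intro θ hθ
    by_contra hnot
    simp only [Set.mem_union, Set.mem_Ioo, not_or, not_and, not_lt] at hnot
    obtain ⟨⟨hθ0, hθ2⟩, hsin⟩ := hθ
    have h0 : c ≤ θ := hnot.1.1 hθ0
    have h1 : c ≤ |θ - π| := by
      rcases le_or_gt θ π with hle | hlt
      · rw [abs_of_nonpos (by linarith)]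
        by_contra hh; push Not at hh
        have := hnot.1.2 (by linarith)
        linarith
      · rw [abs_of_pos (by linarith)]
        by_contra hh; push Not at hh
        have := hnot.1.2 (by linarith)
        linarith
    have h2 : θ ≤ 2 * π - c := by
      by_contra hh; push Not at hh
      exact hnot.2 ⟨hh, hθ2⟩
    have hge := abs_sin_ge_of_far hc0 h0 h1 h2
    have : 2 / π * c = ε := by rw [hc]; field_simp
    linarith
  have hfin : volume (Ioo 0 c ∪ Ioo (π - c) (π + c) ∪ Ioc (2 * π - c) (2 * π)) ≠ ⊤ :=
    ((measure_union_le _ _).trans_lt (ENNReal.add_lt_top.2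
      ⟨(measure_union_le _ _).trans_lt (ENNReal.add_lt_top.2 ⟨measure_Ioo_lt_top, measure_Ioo_lt_top⟩),
        measure_Ioc_lt_top⟩)).ne
  calc volume.real {θ : ℝ | θ ∈ Ioc 0 (2 * π) ∧ |Real.sin θ| < ε}
      ≤ volume.real (Ioo 0 c ∪ Ioo (π - c) (π + c) ∪ Ioc (2 * π - c) (2 * π)) :=
        measureReal_mono hcover hfin
    _ ≤ volume.real (Ioo 0 c ∪ Ioo (π - c) (π + c)) + volume.real (Ioc (2 * π - c) (2 * π)) :=
        measureReal_union_le _ _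
    _ ≤ volume.real (Ioo 0 c) + volume.real (Ioo (π - c) (π + c)) +
          volume.real (Ioc (2 * π - c) (2 * π)) := by
        gcongr; exact measureReal_union_le _ _
    _ = c + 2 * c + c := by
        rw [Real.volume_real_Ioo_of_le (by linarith), Real.volume_real_Ioo_of_le (by linarith),
          Real.volume_real_Ioc_of_le (by linarith)]
        ring
    _ = 2 * π * ε := by rw [hc]; ring

end SinSmall


/-! ### C. Elementary growth lemmas -/

section Growth

/-- From Carleman's inequality `V'' ≥ V'²/(2V) + 2 E_θ` and the Poincaré bound `4 V ≤ a² E_θ`: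
`V''/V' ≥ 4/a` (by the AM–GM inequality). [cite: Romanov2014, App. III proof of Lemma 27] -/
theorem rate_ge {V V' V'' E a : ℝ} (hV : 0 < V) (hV' : 0 < V') (ha : 0 < a)
    (h1 : V' ^ 2 / (2 * V) + 2 * E ≤ V'') (h2 : 4 * V ≤ a ^ 2 * E) : 4 / a ≤ V'' / V' := by
  rw [div_le_div_iff₀ ha hV']
  -- `V'' ≥ V'²/(2V) + 8V/a² ≥ 4 V'/a`
  have hE : 8 * V / a ^ 2 ≤ 2 * E := by
    rw [div_le_iff₀ (by positivity)]; nlinarith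
  have h3 : V' ^ 2 / (2 * V) + 8 * V / a ^ 2 ≤ V'' := by linarith
  have h4 : 4 * V' / a ≤ V' ^ 2 / (2 * V) + 8 * V / a ^ 2 := by
    have h5 : V' ^ 2 / (2 * V) + 8 * V / a ^ 2 - 4 * V' / a = (a * V' - 4 * V) ^ 2 / (2 * V * a ^ 2) := by
      field_simp
      ring
    have h6 : 0 ≤ (a * V' - 4 * V) ^ 2 / (2 * V * a ^ 2) := by positivity
    linarith
  have h7 : 4 * V' / a ≤ V'' := h4.trans h3
  rw [div_le_iff₀ ha] at h7
  linarith

variable {V V' V'' : ℝ → ℝ}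

/-- `V'' ≥ 0` makes `V'` monotone. [folklore] -/
theorem monotone_of_deriv2_nonneg (hd2 : ∀ s, HasDerivAt V' (V'' s) s) (hnn : ∀ s, 0 ≤ V'' s) :
    Monotone V' :=
  monotone_of_deriv_nonneg (fun s => (hd2 s).differentiableAt) fun s => by
    rw [(hd2 s).deriv]; exact hnn s

/-- For convex `V`: `V' (s) ≤ V (s + 1) - V s`. [folklore] -/
theorem deriv_le_sub_of_convex (hd : ∀ s, HasDerivAt V (V' s) s) (hmono : Monotone V') (s : ℝ) :
    V' s ≤ V (s + 1) - V s := by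
  obtain ⟨c, hc, hceq⟩ := exists_hasDerivAt_eq_slope V V' (by linarith : s < s + 1)
    (fun x _ => (hd x).continuousAt.continuousWithinAt) (fun x _ => hd x)
  rw [add_sub_cancel_left, div_one] at hceq
  rw [← hceq]
  exact hmono hc.1.le

/-- If `V' ≤ 0` everywhere then `V` is bounded above on `[0, ∞)` by `V 0`. [folklore] -/
theorem le_apply_zero_of_deriv_nonpos (hd : ∀ s, HasDerivAt V (V' s) s) (hnp : ∀ s, V' s ≤ 0) {s : ℝ}
    (hs : 0 ≤ s) : V s ≤ V 0 :=
  (antitone_of_deriv_nonpos (fun s => (hd s).differentiableAt) fun s => by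
    rw [(hd s).deriv]; exact hnp s) hs

/-- If `V' ≥ 0` everywhere then `V` is monotone. [folklore] -/
theorem monotone_of_deriv_nonneg' (hd : ∀ s, HasDerivAt V (V' s) s) (hnn : ∀ s, 0 ≤ V' s) :
    Monotone V :=
  monotone_of_deriv_nonneg (fun s => (hd s).differentiableAt) fun s => by
    rw [(hd s).deriv]; exact hnn s

/-- A convex function with a point of negative derivative is unbounded above to the left.
[folklore] -/
theorem exists_lt_of_deriv_neg (hd : ∀ s, HasDerivAt V (V' s) s) (hmono : Monotone V') {s₁ : ℝ}
    (hneg : V' s₁ < 0) (C : ℝ) : ∃ s ≤ s₁, C < V s := by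
  -- `V s ≥ V s₁ + V' s₁ (s - s₁)` for `s ≤ s₁`
  have key : ∀ s < s₁, V s₁ - V s ≤ V' s₁ * (s₁ - s) := by
    intro s hs
    obtain ⟨c, hc, hceq⟩ := exists_hasDerivAt_eq_slope V V' hs
      (fun x _ => (hd x).continuousAt.continuousWithinAt) (fun x _ => hd x)
    have hc' : V' c ≤ V' s₁ := hmono hc.2.le
    rw [hceq, div_le_iff₀ (by linarith)] at hc'
    linarith
  set s := min s₁ (s₁ - (C - V s₁ + 1) / (-V' s₁)) - 1 with hs
  have hs1 : s < s₁ := by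
    have : min s₁ (s₁ - (C - V s₁ + 1) / (-V' s₁)) ≤ s₁ := min_le_left _ _
    linarith
  refine ⟨s, hs1.le, ?_⟩
  have h1 := key s hs1
  have h2 : s ≤ s₁ - (C - V s₁ + 1) / (-V' s₁) - 1 := by
    have : min s₁ (s₁ - (C - V s₁ + 1) / (-V' s₁)) ≤ s₁ - (C - V s₁ + 1) / (-V' s₁) := min_le_right _ _
    linarith
  have h3 : (C - V s₁ + 1) / (-V' s₁) ≤ s₁ - s - 1 := by linarith
  rw [div_le_iff₀ (by linarith)] at h3
  nlinarith

/-- A convex function with a point of positive derivative is unbounded above to the right.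
[folklore] -/
theorem exists_lt_of_deriv_pos (hd : ∀ s, HasDerivAt V (V' s) s) (hmono : Monotone V') {s₁ : ℝ}
    (hpos : 0 < V' s₁) (C : ℝ) : ∃ s ≥ s₁, C < V s := by
  have key : ∀ s > s₁, V' s₁ * (s - s₁) ≤ V s - V s₁ := by
    intro s hs
    obtain ⟨c, hc, hceq⟩ := exists_hasDerivAt_eq_slope V V' hs
      (fun x _ => (hd x).continuousAt.continuousWithinAt) (fun x _ => hd x)
    have hc' : V' s₁ ≤ V' c := hmono hc.1.le
    rw [hceq, le_div_iff₀ (by linarith)] at hc'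
    linarith
  set s := max s₁ (s₁ + (C - V s₁ + 1) / V' s₁) + 1 with hs
  have hs1 : s₁ < s := by
    have : s₁ ≤ max s₁ (s₁ + (C - V s₁ + 1) / V' s₁) := le_max_left _ _
    linarith
  refine ⟨s, hs1.le, ?_⟩
  have h1 := key s hs1
  have h2 : s₁ + (C - V s₁ + 1) / V' s₁ + 1 ≤ s := by
    have : s₁ + (C - V s₁ + 1) / V' s₁ ≤ max s₁ (s₁ + (C - V s₁ + 1) / V' s₁) := le_max_right _ _
    linarith
  have h3 : (C - V s₁ + 1) / V' s₁ ≤ s - s₁ - 1 := by linarith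
  rw [div_le_iff₀ hpos] at h3
  nlinarith

/-- **The growth contradiction.** Two positive functions `f₁, f₂` (the `V'` of the two tracts)
with `(log f₁)' + (log f₂)' ≥ 2 + η` on `[s₁, ∞)` cannot both be `O(e^s)`. [folklore] -/
theorem false_of_rates {f₁ f₂ g₁ g₂ : ℝ → ℝ} {s₁ η K : ℝ} (hη : 0 < η) (hK : 0 < K)
    (hd₁ : ∀ s, HasDerivAt f₁ (g₁ s) s) (hd₂ : ∀ s, HasDerivAt f₂ (g₂ s) s)
    (hp₁ : ∀ s, s₁ ≤ s → 0 < f₁ s) (hp₂ : ∀ s, s₁ ≤ s → 0 < f₂ s)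
    (hrate : ∀ s, s₁ ≤ s → 2 + η ≤ g₁ s / f₁ s + g₂ s / f₂ s)
    (hb₁ : ∀ s, s₁ ≤ s → f₁ s ≤ K * Real.exp s) (hb₂ : ∀ s, s₁ ≤ s → f₂ s ≤ K * Real.exp s) :
    False := by
  set G : ℝ → ℝ := fun s => Real.log (f₁ s) + Real.log (f₂ s) - (2 + η) * s with hG
  have hGd : ∀ s, s₁ ≤ s → HasDerivAt G (g₁ s / f₁ s + g₂ s / f₂ s - (2 + η)) s := by
    intro s hs
    have h1 := (hd₁ s).log (hp₁ s hs).ne'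
    have h2 := (hd₂ s).log (hp₂ s hs).ne'
    have h3 := (h1.add h2).sub ((hasDerivAt_id s).const_mul (2 + η))
    refine h3.congr_deriv ?_
    simp
  have hmono : MonotoneOn G (Ici s₁) := by
    refine monotoneOn_of_deriv_nonneg (convex_Ici s₁) ?_ ?_ ?_
    · exact fun s hs => (hGd s hs).continuousAt.continuousWithinAt
    · intro s hs
      rw [interior_Ici] at hs
      exact (hGd s hs.le).differentiableAt.differentiableWithinAt
    · intro s hs
      rw [interior_Ici] at hs
      rw [(hGd s hs.le).deriv]
      linarith [hrate s hs.le]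
  -- compare at `s = max s₁ 0 + T` for large `T`
  have hlog : ∀ s, s₁ ≤ s → Real.log (f₁ s) + Real.log (f₂ s) ≤ 2 * Real.log K + 2 * s := by
    intro s hs
    have h1 : Real.log (f₁ s) ≤ Real.log K + s := by
      have := Real.log_le_log (hp₁ s hs) (hb₁ s hs)
      rwa [Real.log_mul hK.ne' (Real.exp_pos s).ne', Real.log_exp] at this
    have h2 : Real.log (f₂ s) ≤ Real.log K + s := by
      have := Real.log_le_log (hp₂ s hs) (hb₂ s hs)
      rwa [Real.log_mul hK.ne' (Real.exp_pos s).ne', Real.log_exp] at this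
    linarith
  set q : ℝ := (2 * Real.log K - G s₁ + 1) / η with hq
  set s := max s₁ 0 + q + |q| with hs
  have hqq : q ≤ q + |q| := by linarith [abs_nonneg q]
  have hs1 : s₁ ≤ s := by
    have : s₁ ≤ max s₁ 0 := le_max_left _ _
    linarith [abs_nonneg q, neg_abs_le q]
  have hsq : q ≤ s := by
    have : 0 ≤ max s₁ 0 := le_max_right _ _
    linarith [abs_nonneg q, neg_abs_le q]
  have hGs : G s₁ ≤ G s := hmono (Set.mem_Ici.2 le_rfl) (Set.mem_Ici.2 hs1) hs1
  have hup := hlog s hs1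
  have hGs' : G s = Real.log (f₁ s) + Real.log (f₂ s) - (2 + η) * s := rfl
  have h1 : η * s ≤ 2 * Real.log K - G s₁ := by nlinarith
  have h2 : η * q = 2 * Real.log K - G s₁ + 1 := by rw [hq]; field_simp
  have h3 : η * q ≤ η * s := mul_le_mul_of_nonneg_left hsq hη.le
  linarith

end Growth


/-! ### D. Entire functions in logarithmic coordinates -/

section Lift

open _root_.Complex

variable {ξ : ℂ → ℂ}

/-- `Ξ = ξ ∘ exp`: the entire function in the logarithmic coordinate `w = log z`. [folklore] -/
def liftExp (ξ : ℂ → ℂ) : ℂ → ℂ := fun w => ξ (exp w)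

/-- Auxiliary step of the Carleman dichotomy (see the section header). [folklore] -/
theorem differentiable_liftExp (hξ : Differentiable ℂ ξ) : Differentiable ℂ (liftExp ξ) :=
  hξ.comp differentiable_exp

/-- Auxiliary step of the Carleman dichotomy (see the section header). [folklore] -/
theorem liftExp_periodic (ξ : ℂ → ℂ) (w : ℂ) : liftExp ξ (w + 2 * π * I) = liftExp ξ w := by
  simp [liftExp, Complex.exp_add, Complex.exp_two_pi_mul_I]

/-- Auxiliary step of the Carleman dichotomy (see the section header). [folklore] -/
theorem norm_exp_line (s θ : ℝ) : ‖exp ((s : ℂ) + θ * I)‖ = Real.exp s := by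
  rw [norm_exp]; simp

/-- Auxiliary step of the Carleman dichotomy (see the section header). [folklore] -/
theorem continuous_line (s : ℝ) : Continuous fun θ : ℝ => ((s : ℂ) + θ * I) := by fun_prop

/-- Auxiliary step of the Carleman dichotomy (see the section header). [folklore] -/
theorem continuous_tract_line {Ξ : ℂ → ℂ} (hΞ : Differentiable ℂ Ξ) (s : ℝ) :
    Continuous fun θ : ℝ => tract Ξ ((s : ℂ) + θ * I) :=
  Continuous.comp (g := tract Ξ) (f := fun θ : ℝ => ((s : ℂ) + θ * I)) (continuous_tract hΞ)
    (continuous_line s)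

/-- Auxiliary step of the Carleman dichotomy (see the section header). [folklore] -/
theorem exp_line_im (s θ : ℝ) : (exp ((s : ℂ) + θ * I)).im = Real.exp s * Real.sin θ := by
  rw [exp_im]; simp

/-- Growth of the lifted function: `log |Ξ (s + iθ)| ≤ log A + B e^{s/2}`. [folklore] -/
theorem logMod_liftExp_le {A B : ℝ} (hA : 1 ≤ A) (hB : 0 ≤ B)
    (hg : ∀ z, ‖ξ z‖ ≤ A * Real.exp (B * √‖z‖)) (s θ : ℝ) :
    logMod (liftExp ξ) ((s : ℂ) + θ * I) ≤ Real.log A + B * Real.exp (s / 2) := by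
  unfold logMod liftExp
  have hbound := hg (exp ((s : ℂ) + θ * I))
  rw [norm_exp_line, Real.sqrt_eq_rpow, ← Real.exp_mul] at hbound
  have hs2 : s * (1 / 2 : ℝ) = s / 2 := by ring
  rw [hs2] at hbound
  have hnn : 0 ≤ Real.log A + B * Real.exp (s / 2) := by
    have := Real.log_nonneg hA; positivity
  rcases eq_or_lt_of_le (norm_nonneg (ξ (exp ((s : ℂ) + θ * I)))) with h0 | hpos
  · rw [← h0, Real.log_zero]; exact hnn
  · calc Real.log ‖ξ (exp ((s : ℂ) + θ * I))‖ ≤ Real.log (A * Real.exp (B * Real.exp (s / 2))) :=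
          Real.log_le_log hpos hbound
      _ = Real.log A + B * Real.exp (s / 2) := by
          rw [Real.log_mul (by positivity) (Real.exp_pos _).ne', Real.log_exp]

/-- Hence `0 ≤ U ≤ log A + B e^{s/2}`. [folklore] -/
theorem tract_liftExp_le {A B : ℝ} (hA : 1 ≤ A) (hB : 0 ≤ B)
    (hg : ∀ z, ‖ξ z‖ ≤ A * Real.exp (B * √‖z‖)) (s θ : ℝ) :
    tract (liftExp ξ) ((s : ℂ) + θ * I) ≤ Real.log A + B * Real.exp (s / 2) := by
  have h := tract_le (Ξ := liftExp ξ) ((s : ℂ) + θ * I)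
  have hnn : 0 ≤ Real.log A + B * Real.exp (s / 2) := by
    have := Real.log_nonneg hA; positivity
  refine h.trans (max_le ?_ hnn)
  exact logMod_liftExp_le hA hB hg s θ

/-- `V(s) ≤ 2π (log A + B e^{s/2})²`. [folklore] -/
theorem sqInt_liftExp_le (hξ : Differentiable ℂ ξ) {A B : ℝ} (hA : 1 ≤ A) (hB : 0 ≤ B)
    (hg : ∀ z, ‖ξ z‖ ≤ A * Real.exp (B * √‖z‖)) (s : ℝ) :
    sqInt (liftExp ξ) s ≤ 2 * π * (Real.log A + B * Real.exp (s / 2)) ^ 2 := by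
  unfold sqInt
  have hnn : 0 ≤ Real.log A + B * Real.exp (s / 2) := by
    have := Real.log_nonneg hA; positivity
  calc ∫ θ in (0 : ℝ)..2 * π, tract (liftExp ξ) ((s : ℂ) + θ * I) ^ 2
      ≤ ∫ θ in (0 : ℝ)..2 * π, (Real.log A + B * Real.exp (s / 2)) ^ 2 := by
        refine intervalIntegral.integral_mono_on (by positivity) ?_ intervalIntegrable_const ?_
        · exact ((continuous_tract_line (differentiable_liftExp hξ) s).pow 2).intervalIntegrable _ _
        · intro θ _
          exact pow_le_pow_left₀ (tract_nonneg _ _) (tract_liftExp_le hA hB hg s θ) 2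
    _ = 2 * π * (Real.log A + B * Real.exp (s / 2)) ^ 2 := by
        rw [intervalIntegral.integral_const]; simp

/-- `V(s) ≤ K e^s` for `s ≥ 0`, with `K = 4π((log A)² + B²) + 1`. [folklore] -/
theorem sqInt_liftExp_le_exp (hξ : Differentiable ℂ ξ) {A B : ℝ} (hA : 1 ≤ A) (hB : 0 ≤ B)
    (hg : ∀ z, ‖ξ z‖ ≤ A * Real.exp (B * √‖z‖)) {s : ℝ} (hs : 0 ≤ s) :
    sqInt (liftExp ξ) s ≤ (4 * π * (Real.log A ^ 2 + B ^ 2) + 1) * Real.exp s := by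
  have h1 := sqInt_liftExp_le hξ hA hB hg s
  have h2 : (Real.log A + B * Real.exp (s / 2)) ^ 2 ≤ 2 * (Real.log A ^ 2 + B ^ 2 * Real.exp s) := by
    have h3 : Real.exp (s / 2) ^ 2 = Real.exp s := by rw [← Real.exp_nat_mul]; congr 1; ring
    nlinarith [sq_nonneg (Real.log A - B * Real.exp (s / 2))]
  have h4 : 1 ≤ Real.exp s := Real.one_le_exp hs
  have h5 : 0 ≤ 4 * π * Real.log A ^ 2 := by positivity
  have h6 : 4 * π * Real.log A ^ 2 ≤ 4 * π * Real.log A ^ 2 * Real.exp s := le_mul_of_one_le_right h5 h4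
  have h7 : 2 * π * (Real.log A + B * Real.exp (s / 2)) ^ 2 ≤
      2 * π * (2 * (Real.log A ^ 2 + B ^ 2 * Real.exp s)) :=
    mul_le_mul_of_nonneg_left h2 (by positivity)
  have h8 : 0 ≤ Real.exp s := (Real.exp_pos s).le
  nlinarith

/-- `M(s) ≤ 2π (log A + B e^{s/2})`. [folklore] -/
theorem meanInt_liftExp_le (hξ : Differentiable ℂ ξ) {A B : ℝ} (hA : 1 ≤ A) (hB : 0 ≤ B)
    (hg : ∀ z, ‖ξ z‖ ≤ A * Real.exp (B * √‖z‖)) (s : ℝ) :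
    meanInt (liftExp ξ) s ≤ 2 * π * (Real.log A + B * Real.exp (s / 2)) := by
  unfold meanInt
  calc ∫ θ in (0 : ℝ)..2 * π, tract (liftExp ξ) ((s : ℂ) + θ * I)
      ≤ ∫ θ in (0 : ℝ)..2 * π, (Real.log A + B * Real.exp (s / 2)) := by
        refine intervalIntegral.integral_mono_on (by positivity) ?_ intervalIntegrable_const ?_
        · exact (continuous_tract_line (differentiable_liftExp hξ) s).intervalIntegrable _ _
        · intro θ _; exact tract_liftExp_le hA hB hg s θ
    _ = 2 * π * (Real.log A + B * Real.exp (s / 2)) := by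
        rw [intervalIntegral.integral_const]; simp

/-- `M(s)² ≤ 2π V(s)` (Cauchy–Schwarz). [folklore] -/
theorem meanInt_sq_le (hξ : Differentiable ℂ ξ) (s : ℝ) :
    meanInt (liftExp ξ) s ^ 2 ≤ 2 * π * sqInt (liftExp ξ) s := by
  unfold meanInt sqInt
  have := sq_integral_le_mul_integral_sq (f := fun θ : ℝ => tract (liftExp ξ) ((s : ℂ) + θ * I))
    (a := 0) (b := 2 * π) (by positivity) (continuous_tract_line (differentiable_liftExp hξ) s)
  simpa using this

end Lift

/-! ### E. Phragmén–Lindelöf in a strip and the case of a constant function -/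

section Strip

open _root_.Complex

/-- An entire function of growth `O(exp(B √|z|))` that is bounded by `C` off a horizontal strip is
bounded by `C` everywhere (Phragmén–Lindelöf in the strip). [folklore] -/
theorem norm_le_of_le_off_strip {f : ℂ → ℂ} (hf : Differentiable ℂ f) {A B C y₀ : ℝ}
    (hy₀ : 0 < y₀) (hB : 0 ≤ B) (hgrowth : ∀ z, ‖f z‖ ≤ A * Real.exp (B * √‖z‖))
    (hoff : ∀ z : ℂ, y₀ ≤ |z.im| → ‖f z‖ ≤ C) (z : ℂ) : ‖f z‖ ≤ C := by
  by_cases hz : y₀ ≤ |z.im|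
  · exact hoff z hz
  push Not at hz
  have hz' := abs_lt.1 hz
  -- growth in the strip: `‖f z‖ ≤ A' exp((B/c) exp(c |re z|))` with `c = π/(4 y₀)`
  set c : ℝ := π / (4 * y₀) with hc
  have hc0 : 0 < c := by positivity
  have hcl : c < π / (y₀ - -y₀) := by
    rw [hc, sub_neg_eq_add, ← two_mul]
    rw [div_lt_div_iff₀ (by positivity) (by positivity)]
    nlinarith [Real.pi_pos]
  refine PhragmenLindelof.horizontal_strip (a := -y₀) (b := y₀) hf.diffContOnCl ⟨c, hcl, B / c, ?_⟩
    (fun w hw => hoff w (by rw [hw, abs_neg, abs_of_pos hy₀]))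
    (fun w hw => hoff w (by rw [hw, abs_of_pos hy₀])) hz'.1.le hz'.2.le
  -- the `IsBigO` estimate
  refine Asymptotics.IsBigO.of_bound (|A| * Real.exp (B * (y₀ + 1))) ?_
  rw [eventually_inf_principal]
  refine Filter.Eventually.of_forall fun w hw => ?_
  have hwim : |w.im| < y₀ := abs_lt.2 ⟨hw.1, hw.2⟩
  have h1 : ‖w‖ ≤ |w.re| + y₀ := (norm_le_abs_re_add_abs_im w).trans (by linarith)
  have h2 : √‖w‖ ≤ |w.re| + y₀ + 1 := by
    rcases le_or_gt ‖w‖ 1 with hle | hlt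
    · have : √‖w‖ ≤ 1 := Real.sqrt_le_one.mpr hle
      linarith [abs_nonneg w.re]
    · have : √‖w‖ ≤ ‖w‖ := by
        rw [Real.sqrt_le_left (norm_nonneg _)]
        nlinarith
      linarith
  have h3 : |w.re| ≤ Real.exp (c * |w.re|) / c := by
    rw [le_div_iff₀ hc0]
    have := Real.add_one_le_exp (c * |w.re|)
    nlinarith
  have h4 : B * √‖w‖ ≤ B * (y₀ + 1) + B / c * Real.exp (c * |w.re|) := by
    have := mul_le_mul_of_nonneg_left h2 hB
    have h5 : B * |w.re| ≤ B / c * Real.exp (c * |w.re|) := by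
      have := mul_le_mul_of_nonneg_left h3 hB
      have e : B * (Real.exp (c * |w.re|) / c) = B / c * Real.exp (c * |w.re|) := by ring
      linarith [this, e]
    linarith
  calc ‖f w‖ ≤ A * Real.exp (B * √‖w‖) := hgrowth w
    _ ≤ |A| * Real.exp (B * √‖w‖) := by
        exact mul_le_mul_of_nonneg_right (le_abs_self A) (Real.exp_pos _).le
    _ ≤ |A| * Real.exp (B * (y₀ + 1) + B / c * Real.exp (c * |w.re|)) := by
        gcongr
    _ = |A| * Real.exp (B * (y₀ + 1)) * ‖Real.exp (B / c * Real.exp (c * |w.re|))‖ := by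
        rw [Real.exp_add, Real.norm_eq_abs, abs_of_pos (Real.exp_pos _)]; ring

/-- **The case of a constant**: if `ξ₁ ≡ c ≠ 0` then `ξ₂ ≡ 0`. [folklore] -/
theorem eq_zero_of_const {ξ₂ : ℂ → ℂ} (h₂ : Differentiable ℂ ξ₂) {c : ℂ} (hc : c ≠ 0) {A B : ℝ}
    (hB : 0 ≤ B) (hg : ∀ z, ‖ξ₂ z‖ ≤ A * Real.exp (B * √‖z‖))
    (hmin : ∀ z : ℂ, z.im ≠ 0 → min ‖c‖ ‖ξ₂ z‖ ≤ |z.im|⁻¹) : ξ₂ = 0 := by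
  have hcpos : 0 < ‖c‖ := norm_pos_iff.2 hc
  set y₀ : ℝ := 2 / ‖c‖ with hy₀
  have hy₀pos : 0 < y₀ := by positivity
  -- off the strip `|Im z| ≥ y₀`, `‖ξ₂ z‖ ≤ 1/|Im z| ≤ ‖c‖/2`
  have hoff : ∀ z : ℂ, y₀ ≤ |z.im| → ‖ξ₂ z‖ ≤ |z.im|⁻¹ := by
    intro z hz
    have him : z.im ≠ 0 := by
      intro h; rw [h, abs_zero] at hz; linarith
    have h1 : |z.im|⁻¹ ≤ ‖c‖ / 2 := by
      rw [inv_le_comm₀ (abs_pos.2 him) (by positivity)]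
      calc (‖c‖ / 2)⁻¹ = y₀ := by rw [hy₀]; field_simp
        _ ≤ |z.im| := hz
    have h2 := hmin z him
    rcases le_total ‖c‖ ‖ξ₂ z‖ with hle | hle
    · rw [min_eq_left hle] at h2; linarith
    · rw [min_eq_right hle] at h2; exact h2
  have hoff' : ∀ z : ℂ, y₀ ≤ |z.im| → ‖ξ₂ z‖ ≤ ‖c‖ / 2 := by
    intro z hz
    refine (hoff z hz).trans ?_
    have him : z.im ≠ 0 := by
      intro h; rw [h, abs_zero] at hz; linarith
    rw [inv_le_comm₀ (abs_pos.2 him) (by positivity)]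
    calc (‖c‖ / 2)⁻¹ = y₀ := by rw [hy₀]; field_simp
      _ ≤ |z.im| := hz
  have hbdd : ∀ z, ‖ξ₂ z‖ ≤ ‖c‖ / 2 := norm_le_of_le_off_strip h₂ hy₀pos hB hg hoff'
  -- Liouville
  obtain ⟨d, hd⟩ : ∃ d, ∀ z, ξ₂ z = d := by
    refine ⟨ξ₂ 0, fun z => h₂.apply_eq_apply_of_bounded ?_ z 0⟩
    exact isBounded_iff_forall_norm_le.2 ⟨‖c‖ / 2, by rintro _ ⟨z, rfl⟩; exact hbdd z⟩
  -- `‖d‖ ≤ 1/y` for all large `y`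
  have hd0 : d = 0 := by
    by_contra hne
    have hdpos : 0 < ‖d‖ := norm_pos_iff.2 hne
    set y : ℝ := max y₀ (2 / ‖d‖) with hy
    have hyy₀ : y₀ ≤ y := le_max_left _ _
    have hypos : 0 < y := hy₀pos.trans_le hyy₀
    have h1 := hoff ((y : ℂ) * I) (by simpa [abs_of_pos hypos] using hyy₀)
    rw [hd] at h1
    have h2 : |((y : ℂ) * I).im|⁻¹ ≤ ‖d‖ / 2 := by
      have : ((y : ℂ) * I).im = y := by simp
      rw [this, abs_of_pos hypos, inv_le_comm₀ hypos (by positivity)]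
      calc (‖d‖ / 2)⁻¹ = 2 / ‖d‖ := by field_simp
        _ ≤ y := le_max_right _ _
    linarith
  funext z
  rw [hd z, hd0]; rfl

end Strip


/-! ### F. Unboundedness of `V` for a non-constant function -/

section Unbounded

open _root_.Complex

variable {ξ : ℂ → ℂ}

/-- Auxiliary step of the Carleman dichotomy (see the section header). [folklore] -/
theorem sqInt_nonneg' (Ξ : ℂ → ℂ) (s : ℝ) : 0 ≤ sqInt Ξ s :=
  intervalIntegral.integral_nonneg (by positivity) fun θ _ => sq_nonneg _

/-- Auxiliary step of the Carleman dichotomy (see the section header). [folklore] -/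
theorem sqIntS_nonneg (Ξ : ℂ → ℂ) (s : ℝ) : 0 ≤ sqIntS Ξ s :=
  intervalIntegral.integral_nonneg (by positivity) fun θ _ => sq_nonneg _

/-- Auxiliary step of the Carleman dichotomy (see the section header). [folklore] -/
theorem sqIntT_nonneg (Ξ : ℂ → ℂ) (s : ℝ) : 0 ≤ sqIntT Ξ s :=
  intervalIntegral.integral_nonneg (by positivity) fun θ _ => sq_nonneg _

/-- Auxiliary step of the Carleman dichotomy (see the section header). [folklore] -/
theorem meanInt_nonneg (Ξ : ℂ → ℂ) (s : ℝ) : 0 ≤ meanInt Ξ s :=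
  intervalIntegral.integral_nonneg (by positivity) fun θ _ => tract_nonneg _ _

/-- Auxiliary step of the Carleman dichotomy (see the section header). [folklore] -/
theorem sqInt''_nonneg (hξ : Differentiable ℂ ξ) (s : ℝ) : 0 ≤ sqInt'' (liftExp ξ) s := by
  have h := sqInt''_ge (differentiable_liftExp hξ) (liftExp_periodic ξ) s
  linarith [sqIntS_nonneg (liftExp ξ) s, sqIntT_nonneg (liftExp ξ) s]

/-- `M' ≥ 0`: the circular means of `U` are non-decreasing in the radius. [folklore] -/
theorem meanInt'_nonneg (hξ : Differentiable ℂ ξ) {A B : ℝ} (hA : 1 ≤ A) (hB : 0 ≤ B)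
    (hg : ∀ z, ‖ξ z‖ ≤ A * Real.exp (B * √‖z‖)) (s₁ : ℝ) : 0 ≤ meanInt' (liftExp ξ) s₁ := by
  by_contra hneg
  push Not at hneg
  have hΞ := differentiable_liftExp hξ
  have hmono : Monotone (meanInt' (liftExp ξ)) :=
    monotone_of_deriv2_nonneg (hasDerivAt_meanInt' hΞ) (meanInt''_nonneg hΞ (liftExp_periodic ξ))
  set C : ℝ := 2 * π * (Real.log A + B * Real.exp (|s₁| / 2)) with hC
  obtain ⟨s, hs, hCs⟩ := exists_lt_of_deriv_neg (hasDerivAt_meanInt hΞ) hmono hneg C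
  have hM := meanInt_liftExp_le hξ hA hB hg s
  have hexp : Real.exp (s / 2) ≤ Real.exp (|s₁| / 2) :=
    Real.exp_le_exp.2 (by linarith [le_abs_self s₁])
  have : 2 * π * (Real.log A + B * Real.exp (s / 2)) ≤ C := by
    rw [hC]; gcongr
  linarith

/-- Reduction of the angle to a period. [folklore] -/
theorem exists_rep (w : ℂ) : ∃ θ : ℝ, θ ∈ Ico (0 : ℝ) (2 * π) ∧ ∃ n : ℤ,
    w = ((w.re : ℂ) + θ * I) + n * (2 * π * I) := by
  refine ⟨2 * π * Int.fract (w.im / (2 * π)), ⟨?_, ?_⟩, ⌊w.im / (2 * π)⌋, ?_⟩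
  · exact mul_nonneg (by positivity) (Int.fract_nonneg _)
  · have := Int.fract_lt_one (w.im / (2 * π))
    nlinarith [Real.pi_pos]
  · have h := Int.fract_add_floor (w.im / (2 * π))
    have hπ : (2 * π : ℝ) ≠ 0 := by positivity
    have him : w.im = 2 * π * Int.fract (w.im / (2 * π)) + (⌊w.im / (2 * π)⌋ : ℝ) * (2 * π) := by
      have h2 := congrArg (fun x : ℝ => x * (2 * π)) h
      simp only [add_mul, div_mul_cancel₀ _ hπ] at h2
      linarith
    calc w = (w.re : ℂ) + (w.im : ℂ) * I := (re_add_im w).symm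
      _ = ((w.re : ℂ) + ↑(2 * π * Int.fract (w.im / (2 * π))) * I) +
            (⌊w.im / (2 * π)⌋ : ℤ) * (2 * π * I) := by
          conv_lhs => rw [him]
          push_cast
          ring

/-- Auxiliary step of the Carleman dichotomy (see the section header). [folklore] -/
theorem liftExp_add_int_mul (ξ : ℂ → ℂ) (w : ℂ) (n : ℤ) :
    liftExp ξ (w + n * (2 * π * I)) = liftExp ξ w := by
  simp only [liftExp, Complex.exp_add]
  congr 1
  rw [Complex.exp_int_mul_two_pi_mul_I, mul_one]

/-- `H''(log |Ξ|) |Ξ'/Ξ|² ≡ 0` when `V` is bounded on `[0, ∞)`. [folklore] -/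
theorem subharmonic_defect_eq_zero (hξ : Differentiable ℂ ξ) {A B : ℝ} (hA : 1 ≤ A) (hB : 0 ≤ B)
    (hg : ∀ z, ‖ξ z‖ ≤ A * Real.exp (B * √‖z‖)) {Vb : ℝ}
    (hVb : ∀ s, 0 ≤ s → sqInt (liftExp ξ) s ≤ Vb) (w : ℂ) :
    tractSS (liftExp ξ) w + tractTT (liftExp ξ) w = 0 := by
  have hΞ := differentiable_liftExp hξ
  have hper := liftExp_periodic ξ
  set Ξ := liftExp ξ with hΞdef
  -- `M' ≥ 0`, `M` bounded above, hence `M' ≡ 0`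
  have hM'nn : ∀ s, 0 ≤ meanInt' Ξ s := meanInt'_nonneg hξ hA hB hg
  have hMmono : Monotone (meanInt Ξ) := monotone_of_deriv_nonneg' (hasDerivAt_meanInt hΞ) hM'nn
  have hVb0 : 0 ≤ Vb := (sqInt_nonneg' Ξ 0).trans (hVb 0 le_rfl)
  set Mb : ℝ := max (meanInt Ξ 0) (√(2 * π * Vb)) with hMb
  have hMle : ∀ s, meanInt Ξ s ≤ Mb := by
    intro s
    rcases le_or_gt 0 s with hs | hs
    · have h1 := meanInt_sq_le hξ s
      have h2 : meanInt Ξ s ≤ √(2 * π * sqInt Ξ s) := Real.le_sqrt_of_sq_le h1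
      have h3 : √(2 * π * sqInt Ξ s) ≤ √(2 * π * Vb) := Real.sqrt_le_sqrt (by nlinarith [hVb s hs, Real.pi_pos])
      exact (h2.trans h3).trans (le_max_right _ _)
    · exact (hMmono hs.le).trans (le_max_left _ _)
  have hM'mono : Monotone (meanInt' Ξ) :=
    monotone_of_deriv2_nonneg (hasDerivAt_meanInt' hΞ) (meanInt''_nonneg hΞ hper)
  have hM'zero : ∀ s, meanInt' Ξ s = 0 := by
    intro s
    refine le_antisymm ?_ (hM'nn s)
    by_contra hpos
    push Not at hpos
    obtain ⟨s', -, hs'⟩ := exists_lt_of_deriv_pos (hasDerivAt_meanInt hΞ) hM'mono hpos Mb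
    exact absurd (hMle s') (not_le.2 hs')
  have hM''zero : ∀ s, meanInt'' Ξ s = 0 := by
    intro s
    have hfun : meanInt' Ξ = fun _ => (0 : ℝ) := funext hM'zero
    have h := hasDerivAt_meanInt' hΞ s
    rw [hfun] at h
    exact h.unique (hasDerivAt_const s (0 : ℝ))
  -- the non-negative continuous integrand of `M''` vanishes on every circle
  have hline : ∀ s : ℝ, ∀ θ ∈ Icc (0 : ℝ) (2 * π),
      tractSS Ξ ((s : ℂ) + θ * I) + tractTT Ξ ((s : ℂ) + θ * I) = 0 := by
    intro s
    by_contra hex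
    push Not at hex
    obtain ⟨θ₀, hθ₀, hne⟩ := hex
    have hposθ₀ : 0 < tractSS Ξ ((s : ℂ) + θ₀ * I) + tractTT Ξ ((s : ℂ) + θ₀ * I) :=
      lt_of_le_of_ne (tractSS_add_tractTT_nonneg Ξ _) (Ne.symm hne)
    have hcont : Continuous fun θ : ℝ => tractSS Ξ ((s : ℂ) + θ * I) + tractTT Ξ ((s : ℂ) + θ * I) :=
      (Continuous.comp (g := tractSS Ξ) (continuous_tractSS hΞ) (continuous_line s)).add
        (Continuous.comp (g := tractTT Ξ) (continuous_tractTT hΞ) (continuous_line s))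
    have hlt := intervalIntegral.integral_lt_integral_of_continuousOn_of_le_of_exists_lt
      (f := fun _ => (0 : ℝ)) (g := fun θ : ℝ => tractSS Ξ ((s : ℂ) + θ * I) + tractTT Ξ ((s : ℂ) + θ * I))
      (a := 0) (b := 2 * π) (by positivity) continuousOn_const hcont.continuousOn
      (fun θ _ => tractSS_add_tractTT_nonneg Ξ _) ⟨θ₀, hθ₀, hposθ₀⟩
    have hiS : IntervalIntegrable (fun θ : ℝ => tractSS Ξ ((s : ℂ) + θ * I)) volume 0 (2 * π) :=
      (Continuous.comp (g := tractSS Ξ) (continuous_tractSS hΞ) (continuous_line s)).intervalIntegrable _ _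
    have hiT : IntervalIntegrable (fun θ : ℝ => tractTT Ξ ((s : ℂ) + θ * I)) volume 0 (2 * π) :=
      (Continuous.comp (g := tractTT Ξ) (continuous_tractTT hΞ) (continuous_line s)).intervalIntegrable _ _
    have hsum : ∫ θ in (0 : ℝ)..2 * π, (tractSS Ξ ((s : ℂ) + θ * I) + tractTT Ξ ((s : ℂ) + θ * I)) =
        meanInt'' Ξ s + ∫ θ in (0 : ℝ)..2 * π, tractTT Ξ ((s : ℂ) + θ * I) := by
      rw [intervalIntegral.integral_add hiS hiT, meanInt'']
    rw [intervalIntegral.integral_const, hsum, hM''zero s, integral_tractTT hΞ hper s] at hlt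
    simp at hlt
  -- reduce an arbitrary `w` to the fundamental strip
  obtain ⟨θ, hθ, n, hw⟩ := exists_rep w
  have hperS : tractSS Ξ w = tractSS Ξ ((w.re : ℂ) + θ * I) := by
    have e : ((w.re : ℂ) + θ * I) = w + ((-n : ℤ) : ℂ) * (2 * π * I) := by
      push_cast; linear_combination -hw
    rw [e, tractSS, tractSS, logMod, logMod]
    have hp : ∀ v, Ξ (v + ((-n : ℤ) : ℂ) * (2 * π * I)) = Ξ v := fun v => liftExp_add_int_mul ξ v (-n)
    rw [hp, logDeriv_periodic hp, deriv_logDeriv_periodic hp]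
  have hperT : tractTT Ξ w = tractTT Ξ ((w.re : ℂ) + θ * I) := by
    have e : ((w.re : ℂ) + θ * I) = w + ((-n : ℤ) : ℂ) * (2 * π * I) := by
      push_cast; linear_combination -hw
    rw [e, tractTT, tractTT, logMod, logMod]
    have hp : ∀ v, Ξ (v + ((-n : ℤ) : ℂ) * (2 * π * I)) = Ξ v := fun v => liftExp_add_int_mul ξ v (-n)
    rw [hp, logDeriv_periodic hp, deriv_logDeriv_periodic hp]
  rw [hperS, hperT]
  exact hline w.re θ ⟨hθ.1, hθ.2.le⟩

/-- A non-constant entire function is unbounded. [folklore] -/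
theorem exists_norm_gt_of_nonconst (hξ : Differentiable ℂ ξ) (hnc : ∃ z, ξ z ≠ ξ 0) (R : ℝ) :
    ∃ z, R < ‖ξ z‖ := by
  by_contra h
  push Not at h
  obtain ⟨z, hz⟩ := hnc
  have hb : Bornology.IsBounded (Set.range ξ) :=
    isBounded_iff_forall_norm_le.2 ⟨R, by rintro _ ⟨y, rfl⟩; exact h y⟩
  exact hz (hξ.apply_eq_apply_of_bounded hb z 0)

/-- **`V` is unbounded** on `[0, ∞)` for a non-constant entire `ξ`. [folklore] -/
theorem exists_sqInt_gt (hξ : Differentiable ℂ ξ) {A B : ℝ} (hA : 1 ≤ A) (hB : 0 ≤ B)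
    (hg : ∀ z, ‖ξ z‖ ≤ A * Real.exp (B * √‖z‖)) (hnc : ∃ z, ξ z ≠ ξ 0) (Vb : ℝ) :
    ∃ s, 0 ≤ s ∧ Vb < sqInt (liftExp ξ) s := by
  by_contra hcon
  push Not at hcon
  have hΞ := differentiable_liftExp hξ
  set Ξ := liftExp ξ with hΞdef
  have hdef := subharmonic_defect_eq_zero hξ hA hB hg hcon
  -- a point where `|ξ| > e²`
  obtain ⟨z₀, hz₀⟩ := exists_norm_gt_of_nonconst hξ hnc (max (Real.exp 2) ‖ξ 0‖)
  have hz₀ne : z₀ ≠ 0 := by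
    intro h; rw [h] at hz₀; exact absurd hz₀ (not_lt.2 (le_max_right _ _))
  have hz₀e : Real.exp 2 < ‖ξ z₀‖ := (le_max_left _ _).trans_lt hz₀
  set w₀ := Complex.log z₀ with hw₀
  have hexp : Complex.exp w₀ = z₀ := Complex.exp_log hz₀ne
  -- on the open set `{|Ξ| > e²}`, `Ξ' = 0`
  set O : Set ℂ := {w | Real.exp 2 < ‖Ξ w‖} with hO
  have hOopen : IsOpen O := isOpen_lt continuous_const (continuous_norm.comp hΞ.continuous)
  have hw₀O : w₀ ∈ O := by
    show Real.exp 2 < ‖ξ (Complex.exp w₀)‖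
    rw [hexp]; exact hz₀e
  have hderivO : ∀ w ∈ O, deriv Ξ w = 0 := by
    intro w hw
    have hw' : Real.exp 2 < ‖Ξ w‖ := hw
    have hΞw : Ξ w ≠ 0 := by
      intro h; rw [h, norm_zero] at hw'; exact absurd hw' (not_lt.2 (Real.exp_pos 2).le)
    have hlog : 1 < logMod Ξ w := by
      refine one_lt_logMod_of_lt_norm (lt_trans ?_ hw')
      exact Real.exp_lt_exp.2 (by norm_num)
    have hpos : 0 < deriv (deriv sramp) (logMod Ξ w) := deriv2_ramp_pos hlog
    have h0 := hdef w
    rw [tractSS_add_tractTT] at h0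
    have hn : ‖logDeriv Ξ w‖ ^ 2 = 0 := by
      rcases mul_eq_zero.1 h0 with h | h
      · exact absurd h hpos.ne'
      · exact h
    have hld : logDeriv Ξ w = 0 := by
      have : ‖logDeriv Ξ w‖ = 0 := by
        have := pow_eq_zero_iff (n := 2) (two_ne_zero) |>.1 hn
        exact this
      exact norm_eq_zero.1 this
    rw [logDeriv_apply, div_eq_zero_iff] at hld
    exact hld.resolve_right hΞw
  -- identity theorem for `Ξ'`
  have hdiff' : Differentiable ℂ (deriv Ξ) := fun w => ((hΞ.analyticAt w).deriv).differentiableAt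
  have han : AnalyticOnNhd ℂ (deriv Ξ) Set.univ := (hdiff'.differentiableOn).analyticOnNhd isOpen_univ
  have hev : deriv Ξ =ᶠ[𝓝 w₀] 0 :=
    Filter.eventually_of_mem (hOopen.mem_nhds hw₀O) fun w hw => hderivO w hw
  have hzero : Set.EqOn (deriv Ξ) 0 Set.univ :=
    han.eqOn_zero_of_preconnected_of_eventuallyEq_zero isPreconnected_univ (Set.mem_univ w₀) hev
  have hconst : ∀ x y, Ξ x = Ξ y := is_const_of_deriv_eq_zero hΞ fun w => hzero (Set.mem_univ w)
  -- hence `ξ` is constant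
  have hξ1 : ∀ z, z ≠ 0 → ξ z = ξ 1 := by
    intro z hz
    have h1 : ξ z = Ξ (Complex.log z) := by
      show ξ z = ξ (Complex.exp (Complex.log z)); rw [Complex.exp_log hz]
    have h2 : ξ 1 = Ξ 0 := by
      show ξ 1 = ξ (Complex.exp 0); rw [Complex.exp_zero]
    rw [h1, h2]; exact hconst _ _
  have hξ0 : ξ 0 = ξ 1 := by
    have hc : ContinuousAt ξ 0 := hξ.continuous.continuousAt
    have ht : Filter.Tendsto ξ (𝓝[≠] (0 : ℂ)) (𝓝 (ξ 0)) := hc.tendsto.mono_left nhdsWithin_le_nhds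
    have ht' : Filter.Tendsto ξ (𝓝[≠] (0 : ℂ)) (𝓝 (ξ 1)) := by
      refine (tendsto_const_nhds (x := ξ 1)).congr' ?_
      exact Filter.eventually_of_mem self_mem_nhdsWithin fun z hz => (hξ1 z hz).symm
    exact tendsto_nhds_unique ht ht'
  obtain ⟨z, hz⟩ := hnc
  rcases eq_or_ne z 0 with h | h
  · exact hz (by rw [h])
  · exact hz (by rw [hξ1 z h, hξ0])

end Unbounded


/-! ### G. The dichotomy -/

section Main

open _root_.Complex

/-- The measure of the positivity set of `θ ↦ U(s + iθ)` in a period. [folklore] -/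
def posMeasure (Ξ : ℂ → ℂ) (s : ℝ) : ℝ :=
  volume.real (posSet (fun θ : ℝ => tract Ξ ((s : ℂ) + θ * I)) ∩ Ioc 0 (2 * π))

/-- Auxiliary step of the Carleman dichotomy (see the section header). [folklore] -/
theorem posMeasure_nonneg (Ξ : ℂ → ℂ) (s : ℝ) : 0 ≤ posMeasure Ξ s := measureReal_nonneg

/-- Auxiliary step of the Carleman dichotomy (see the section header). [folklore] -/
theorem posMeasure_le (Ξ : ℂ → ℂ) (s : ℝ) : posMeasure Ξ s ≤ 2 * π := by
  unfold posMeasure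
  calc volume.real (posSet (fun θ : ℝ => tract Ξ ((s : ℂ) + θ * I)) ∩ Ioc 0 (2 * π))
      ≤ volume.real (Ioc 0 (2 * π)) := measureReal_mono Set.inter_subset_right measure_Ioc_lt_top.ne
    _ = 2 * π := by rw [Real.volume_real_Ioc_of_le (by positivity)]; ring

variable {ξ ξ₁ ξ₂ : ℂ → ℂ}

/-- `V > 0` to the right of a point where `V' > 0`. [folklore] -/
theorem sqInt_pos_of (hξ : Differentiable ℂ ξ) {s₀ s : ℝ} (h0 : 0 < sqInt' (liftExp ξ) s₀) (hs : s₀ < s) :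
    0 < sqInt (liftExp ξ) s := by
  have hΞ := differentiable_liftExp hξ
  have hmono : Monotone (sqInt' (liftExp ξ)) :=
    monotone_of_deriv2_nonneg (hasDerivAt_sqInt' hΞ) (sqInt''_nonneg hξ)
  obtain ⟨c, hc, hceq⟩ := exists_hasDerivAt_eq_slope (sqInt (liftExp ξ)) (sqInt' (liftExp ξ)) hs
    (fun x _ => (hasDerivAt_sqInt hΞ x).continuousAt.continuousWithinAt) (fun x _ => hasDerivAt_sqInt hΞ x)
  have h1 : sqInt' (liftExp ξ) s₀ ≤ sqInt' (liftExp ξ) c := hmono hc.1.le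
  rw [hceq, le_div_iff₀ (by linarith)] at h1
  have h2 := sqInt_nonneg' (liftExp ξ) s₀
  nlinarith

/-- **Rate inequality for one tract**: if `U(s, ·)` has a zero on the circle then
`V''/V' ≥ 4/a(s)` and `a(s) > 0`. [cite: Romanov2014, App. III proof of Lemma 27] -/
theorem rate_of_exists_zero (hξ : Differentiable ℂ ξ) {s : ℝ} (hV : 0 < sqInt (liftExp ξ) s)
    (hV' : 0 < sqInt' (liftExp ξ) s) (hz : ∃ θ₀ : ℝ, tract (liftExp ξ) ((s : ℂ) + θ₀ * I) = 0) :
    0 < posMeasure (liftExp ξ) s ∧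
      4 / posMeasure (liftExp ξ) s ≤ sqInt'' (liftExp ξ) s / sqInt' (liftExp ξ) s := by
  have hΞ := differentiable_liftExp hξ
  have hper := liftExp_periodic ξ
  set Ξ := liftExp ξ with hΞdef
  obtain ⟨θ₀, hθ₀⟩ := hz
  -- Poincaré for `u(θ) = U(s + iθ)`
  set u : ℝ → ℝ := fun θ => tract Ξ ((s : ℂ) + θ * I) with hu
  set u' : ℝ → ℝ := fun θ => tractT Ξ ((s : ℂ) + θ * I) with hu'
  have hperu : Function.Periodic u (2 * π) := by
    intro θ
    simp only [hu]
    have : ((s : ℂ) + ((θ + 2 * π : ℝ) : ℂ) * I) = ((s : ℂ) + θ * I) + 2 * π * I := by push_cast; ring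
    rw [this, tract_periodic hper]
  have hderu : ∀ θ, HasDerivAt u (u' θ) θ := fun θ => hasDerivAt_tract_im hΞ s θ
  have hu'c : Continuous u' := Continuous.comp (g := tractT Ξ) (continuous_tractT hΞ) (continuous_line s)
  have hP := four_mul_integral_sq_le hperu (by positivity) hderu hu'c (θ₀ := θ₀) hθ₀
  -- `hP : 4 V ≤ a² E_θ`
  change 4 * sqInt Ξ s ≤ posMeasure Ξ s ^ 2 * sqIntT Ξ s at hP
  have ha0 : 0 ≤ posMeasure Ξ s := posMeasure_nonneg Ξ s
  have hapos : 0 < posMeasure Ξ s := by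
    rcases eq_or_lt_of_le ha0 with h | h
    · rw [← h] at hP; nlinarith
    · exact h
  refine ⟨hapos, ?_⟩
  -- Carleman: `V'' ≥ V'²/(2V) + 2 E_θ`
  have hC := sqInt''_ge hΞ hper s
  have hCS := sqInt'_sq_le hΞ s
  have h1 : sqInt' Ξ s ^ 2 / (2 * sqInt Ξ s) + 2 * sqIntT Ξ s ≤ sqInt'' Ξ s := by
    have : sqInt' Ξ s ^ 2 / (2 * sqInt Ξ s) ≤ 2 * sqIntS Ξ s := by
      rw [div_le_iff₀ (by positivity)]; nlinarith
    linarith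
  exact rate_ge hV hV' hapos h1 hP

/-- The positivity sets of the two tracts overlap only where `|sin θ| < e^{-s-1}`. [folklore] -/
theorem posSet_inter_subset (hmin : ∀ z : ℂ, z.im ≠ 0 → min ‖ξ₁ z‖ ‖ξ₂ z‖ ≤ |z.im|⁻¹) (s : ℝ) :
    posSet (fun θ : ℝ => tract (liftExp ξ₁) ((s : ℂ) + θ * I)) ∩
        posSet (fun θ : ℝ => tract (liftExp ξ₂) ((s : ℂ) + θ * I)) ∩ Ioc 0 (2 * π) ⊆
      {θ : ℝ | θ ∈ Ioc 0 (2 * π) ∧ |Real.sin θ| < Real.exp (-s - 1)} := by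
  rintro θ ⟨⟨h1, h2⟩, hθ⟩
  refine ⟨hθ, ?_⟩
  have hp1 : Real.exp 1 < ‖ξ₁ (exp ((s : ℂ) + θ * I))‖ := by
    have : 0 < tract (liftExp ξ₁) ((s : ℂ) + θ * I) := lt_of_le_of_ne (tract_nonneg _ _) (Ne.symm h1)
    exact tract_pos_iff.1 this
  have hp2 : Real.exp 1 < ‖ξ₂ (exp ((s : ℂ) + θ * I))‖ := by
    have : 0 < tract (liftExp ξ₂) ((s : ℂ) + θ * I) := lt_of_le_of_ne (tract_nonneg _ _) (Ne.symm h2)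
    exact tract_pos_iff.1 this
  set z : ℂ := exp ((s : ℂ) + θ * I) with hz
  have hzim : z.im = Real.exp s * Real.sin θ := exp_line_im s θ
  by_cases hsin : Real.sin θ = 0
  · rw [hsin, abs_zero]; exact Real.exp_pos _
  · have him : z.im ≠ 0 := by rw [hzim]; exact mul_ne_zero (Real.exp_pos s).ne' hsin
    have hm := hmin z him
    have hlt : Real.exp 1 < |z.im|⁻¹ := lt_of_lt_of_le (lt_min hp1 hp2) hm
    have h3 : |z.im| < (Real.exp 1)⁻¹ := by
      rw [lt_inv_comm₀ (abs_pos.2 him) (Real.exp_pos 1)]; exact hlt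
    rw [hzim, abs_mul, abs_of_pos (Real.exp_pos s)] at h3
    rw [show Real.exp (-s - 1) = (Real.exp 1)⁻¹ / Real.exp s by
      rw [← Real.exp_neg, ← Real.exp_sub]; congr 1; ring]
    rw [lt_div_iff₀ (Real.exp_pos s)]
    linarith

/-- Auxiliary step of the Carleman dichotomy (see the section header). [folklore] -/
theorem isOpen_posSet_line {Ξ : ℂ → ℂ} (hΞ : Differentiable ℂ Ξ) (s : ℝ) :
    IsOpen (posSet fun θ : ℝ => tract Ξ ((s : ℂ) + θ * I)) :=
  isOpen_posSet (continuous_tract_line hΞ s)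

/-- `a₁(s) + a₂(s) ≤ 2π + 2π e^{-s-1}`. [folklore] -/
theorem posMeasure_add_le (h₂ : Differentiable ℂ ξ₂)
    (hmin : ∀ z : ℂ, z.im ≠ 0 → min ‖ξ₁ z‖ ‖ξ₂ z‖ ≤ |z.im|⁻¹) (s : ℝ) :
    posMeasure (liftExp ξ₁) s + posMeasure (liftExp ξ₂) s ≤ 2 * π + 2 * π * Real.exp (-s - 1) := by
  set P₁ := posSet (fun θ : ℝ => tract (liftExp ξ₁) ((s : ℂ) + θ * I)) with hP₁
  set P₂ := posSet (fun θ : ℝ => tract (liftExp ξ₂) ((s : ℂ) + θ * I)) with hP₂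
  set W : Set ℝ := Ioc 0 (2 * π) with hW
  have hm2 : MeasurableSet (P₂ ∩ W) :=
    (isOpen_posSet_line (differentiable_liftExp h₂) s).measurableSet.inter measurableSet_Ioc
  have hfin1 : volume (P₁ ∩ W) ≠ ⊤ := ((measure_mono Set.inter_subset_right).trans_lt measure_Ioc_lt_top).ne
  have hfin2 : volume (P₂ ∩ W) ≠ ⊤ := ((measure_mono Set.inter_subset_right).trans_lt measure_Ioc_lt_top).ne
  have key := measureReal_union_add_inter (μ := volume) (s := P₁ ∩ W) hm2 hfin1 hfin2
  have hU : volume.real (P₁ ∩ W ∪ P₂ ∩ W) ≤ 2 * π := by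
    calc volume.real (P₁ ∩ W ∪ P₂ ∩ W) ≤ volume.real W :=
          measureReal_mono (Set.union_subset Set.inter_subset_right Set.inter_subset_right)
            measure_Ioc_lt_top.ne
      _ = 2 * π := by rw [hW, Real.volume_real_Ioc_of_le (by positivity)]; ring
  have hI : volume.real (P₁ ∩ W ∩ (P₂ ∩ W)) ≤ 2 * π * Real.exp (-s - 1) := by
    have hsub : P₁ ∩ W ∩ (P₂ ∩ W) ⊆ {θ : ℝ | θ ∈ Ioc 0 (2 * π) ∧ |Real.sin θ| < Real.exp (-s - 1)} := by
      rintro θ ⟨⟨h1, hw⟩, h2, -⟩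
      exact posSet_inter_subset hmin s ⟨⟨h1, h2⟩, hw⟩
    refine (measureReal_mono hsub ?_).trans (volume_real_abs_sin_lt_le (Real.exp_pos _).le)
    exact ((measure_mono fun θ hθ => hθ.1).trans_lt measure_Ioc_lt_top).ne
  change volume.real (P₁ ∩ W) + volume.real (P₂ ∩ W) ≤ _
  linarith

/-- If `U₁(s, ·) > 0` on the whole circle then `a₂(s) ≤ 2π e^{-s-1}`. [folklore] -/
theorem posMeasure_le_of_forall_pos (hmin : ∀ z : ℂ, z.im ≠ 0 → min ‖ξ₁ z‖ ‖ξ₂ z‖ ≤ |z.im|⁻¹)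
    {s : ℝ} (hall : ∀ θ : ℝ, tract (liftExp ξ₁) ((s : ℂ) + θ * I) ≠ 0) :
    posMeasure (liftExp ξ₂) s ≤ 2 * π * Real.exp (-s - 1) := by
  unfold posMeasure
  have hsub : posSet (fun θ : ℝ => tract (liftExp ξ₂) ((s : ℂ) + θ * I)) ∩ Ioc 0 (2 * π) ⊆
      {θ : ℝ | θ ∈ Ioc 0 (2 * π) ∧ |Real.sin θ| < Real.exp (-s - 1)} := by
    rintro θ ⟨h2, hw⟩
    exact posSet_inter_subset hmin s ⟨⟨hall θ, h2⟩, hw⟩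
  refine (measureReal_mono hsub ?_).trans (volume_real_abs_sin_lt_le (Real.exp_pos _).le)
  exact ((measure_mono fun θ hθ => hθ.1).trans_lt measure_Ioc_lt_top).ne

/-- If `U(s, ·) > 0` on the whole circle then `a(s) = 2π`. [folklore] -/
theorem posMeasure_eq_of_forall_pos {Ξ : ℂ → ℂ} {s : ℝ} (hall : ∀ θ : ℝ, tract Ξ ((s : ℂ) + θ * I) ≠ 0) :
    posMeasure Ξ s = 2 * π := by
  unfold posMeasure
  have : posSet (fun θ : ℝ => tract Ξ ((s : ℂ) + θ * I)) = Set.univ := Set.eq_univ_of_forall hall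
  rw [this, Set.univ_inter, Real.volume_real_Ioc_of_le (by positivity)]; ring

/-- Numerical constant: `2π e^{-2} < 1`. [folklore] -/
theorem two_pi_mul_exp_neg_two_lt_one : 2 * π * Real.exp (-2) < 1 := by
  have hpi := Real.pi_lt_d2
  have he := Real.exp_one_gt_d9
  have h1 : Real.exp 2 = Real.exp 1 ^ 2 := by rw [← Real.exp_nat_mul]; norm_num
  have h2 : (7 : ℝ) < Real.exp 2 := by rw [h1]; nlinarith
  rw [Real.exp_neg, mul_inv_lt_iff₀ (Real.exp_pos 2)]
  linarith

/-- **Both functions non-constant is impossible** (Carleman's method).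
[cite: Romanov2014, App. III Proposition 26] -/
theorem false_of_nonconst (h₁ : Differentiable ℂ ξ₁) (h₂ : Differentiable ℂ ξ₂) {A B : ℝ}
    (hA : 1 ≤ A) (hB : 0 ≤ B) (hg₁ : ∀ z, ‖ξ₁ z‖ ≤ A * Real.exp (B * √‖z‖))
    (hg₂ : ∀ z, ‖ξ₂ z‖ ≤ A * Real.exp (B * √‖z‖))
    (hmin : ∀ z : ℂ, z.im ≠ 0 → min ‖ξ₁ z‖ ‖ξ₂ z‖ ≤ |z.im|⁻¹)
    (hnc₁ : ∃ z, ξ₁ z ≠ ξ₁ 0) (hnc₂ : ∃ z, ξ₂ z ≠ ξ₂ 0) : False := by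
  have hΞ₁ := differentiable_liftExp h₁
  have hΞ₂ := differentiable_liftExp h₂
  set Ξ₁ := liftExp ξ₁ with hΞ₁def
  set Ξ₂ := liftExp ξ₂ with hΞ₂def
  have hmono₁ : Monotone (sqInt' Ξ₁) := monotone_of_deriv2_nonneg (hasDerivAt_sqInt' hΞ₁) (sqInt''_nonneg h₁)
  have hmono₂ : Monotone (sqInt' Ξ₂) := monotone_of_deriv2_nonneg (hasDerivAt_sqInt' hΞ₂) (sqInt''_nonneg h₂)
  -- points with `V' > 0`
  obtain ⟨t₁, ht₁⟩ : ∃ t, 0 < sqInt' Ξ₁ t := by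
    by_contra hall
    push Not at hall
    obtain ⟨s, hs, hlt⟩ := exists_sqInt_gt h₁ hA hB hg₁ hnc₁ (sqInt Ξ₁ 0)
    exact absurd (le_apply_zero_of_deriv_nonpos (hasDerivAt_sqInt hΞ₁) hall hs) (not_le.2 hlt)
  obtain ⟨t₂, ht₂⟩ : ∃ t, 0 < sqInt' Ξ₂ t := by
    by_contra hall
    push Not at hall
    obtain ⟨s, hs, hlt⟩ := exists_sqInt_gt h₂ hA hB hg₂ hnc₂ (sqInt Ξ₂ 0)
    exact absurd (le_apply_zero_of_deriv_nonpos (hasDerivAt_sqInt hΞ₂) hall hs) (not_le.2 hlt)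
  set s₁ : ℝ := max (max t₁ t₂) 0 + 1 with hs₁
  have hs₁t₁ : t₁ < s₁ := by
    have : t₁ ≤ max (max t₁ t₂) 0 := (le_max_left _ _).trans (le_max_left _ _); linarith
  have hs₁t₂ : t₂ < s₁ := by
    have : t₂ ≤ max (max t₁ t₂) 0 := (le_max_right _ _).trans (le_max_left _ _); linarith
  have hs₁1 : 1 ≤ s₁ := by have : 0 ≤ max (max t₁ t₂) 0 := le_max_right _ _; linarith
  have hV'₁ : ∀ s, s₁ ≤ s → 0 < sqInt' Ξ₁ s := fun s hs => ht₁.trans_le (hmono₁ (by linarith))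
  have hV'₂ : ∀ s, s₁ ≤ s → 0 < sqInt' Ξ₂ s := fun s hs => ht₂.trans_le (hmono₂ (by linarith))
  have hV₁ : ∀ s, s₁ ≤ s → 0 < sqInt Ξ₁ s := fun s hs => sqInt_pos_of h₁ ht₁ (by linarith)
  have hV₂ : ∀ s, s₁ ≤ s → 0 < sqInt Ξ₂ s := fun s hs => sqInt_pos_of h₂ ht₂ (by linarith)
  -- the rate inequality
  set η : ℝ := 16 / (2 * π + 1) - 2 with hη
  have hηpos : 0 < η := by
    rw [hη, sub_pos, lt_div_iff₀ (by positivity)]; nlinarith [Real.pi_lt_d2]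
  have hηle : 2 + η ≤ 4 := by
    rw [hη]
    have : 16 / (2 * π + 1) ≤ 4 := by
      rw [div_le_iff₀ (by positivity)]; nlinarith [Real.pi_gt_three]
    linarith
  have hrate : ∀ s, s₁ ≤ s →
      2 + η ≤ sqInt'' Ξ₁ s / sqInt' Ξ₁ s + sqInt'' Ξ₂ s / sqInt' Ξ₂ s := by
    intro s hs
    have hδ : 2 * π * Real.exp (-s - 1) < 1 := by
      have : Real.exp (-s - 1) ≤ Real.exp (-2) := Real.exp_le_exp.2 (by linarith)
      nlinarith [two_pi_mul_exp_neg_two_lt_one, Real.pi_pos, Real.exp_pos (-s - 1)]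
    have hr₁0 : 0 ≤ sqInt'' Ξ₁ s / sqInt' Ξ₁ s := div_nonneg (sqInt''_nonneg h₁ s) (hV'₁ s hs).le
    have hr₂0 : 0 ≤ sqInt'' Ξ₂ s / sqInt' Ξ₂ s := div_nonneg (sqInt''_nonneg h₂ s) (hV'₂ s hs).le
    by_cases hz₁ : ∃ θ₀ : ℝ, tract Ξ₁ ((s : ℂ) + θ₀ * I) = 0
    · by_cases hz₂ : ∃ θ₀ : ℝ, tract Ξ₂ ((s : ℂ) + θ₀ * I) = 0
      · -- both tracts have zeros on the circle
        obtain ⟨ha₁, hr₁⟩ := rate_of_exists_zero h₁ (hV₁ s hs) (hV'₁ s hs) hz₁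
        obtain ⟨ha₂, hr₂⟩ := rate_of_exists_zero h₂ (hV₂ s hs) (hV'₂ s hs) hz₂
        have hsum := posMeasure_add_le h₂ hmin s
        set a₁ := posMeasure Ξ₁ s
        set a₂ := posMeasure Ξ₂ s
        have hhm : 16 / (a₁ + a₂) ≤ 4 / a₁ + 4 / a₂ := by
          rw [div_add_div _ _ ha₁.ne' ha₂.ne', div_le_div_iff₀ (by positivity) (by positivity)]
          nlinarith [sq_nonneg (a₁ - a₂), ha₁, ha₂]
        have hmon : 16 / (2 * π + 1) ≤ 16 / (a₁ + a₂) :=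
          div_le_div_of_nonneg_left (by norm_num) (by positivity) (by linarith)
        linarith
      · -- `U₂ > 0` on the circle: then `a₁ ≤ 2π e^{-s-1} < 1`
        push Not at hz₂
        have hmin' : ∀ z : ℂ, z.im ≠ 0 → min ‖ξ₂ z‖ ‖ξ₁ z‖ ≤ |z.im|⁻¹ := fun z hz => by
          rw [min_comm]; exact hmin z hz
        have ha₁small := posMeasure_le_of_forall_pos hmin' hz₂
        obtain ⟨ha₁, hr₁⟩ := rate_of_exists_zero h₁ (hV₁ s hs) (hV'₁ s hs) hz₁
        have ha₁lt : posMeasure Ξ₁ s < 1 := by linarith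
        have h4 : 4 ≤ 4 / posMeasure Ξ₁ s := by
          rw [le_div_iff₀ ha₁]; nlinarith
        linarith
    · push Not at hz₁
      have ha₂small := posMeasure_le_of_forall_pos hmin hz₁
      by_cases hz₂ : ∃ θ₀ : ℝ, tract Ξ₂ ((s : ℂ) + θ₀ * I) = 0
      · obtain ⟨ha₂, hr₂⟩ := rate_of_exists_zero h₂ (hV₂ s hs) (hV'₂ s hs) hz₂
        have ha₂lt : posMeasure Ξ₂ s < 1 := by linarith
        have h4 : 4 ≤ 4 / posMeasure Ξ₂ s := by
          rw [le_div_iff₀ ha₂]; nlinarith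
        linarith
      · -- both tracts positive on the whole circle: impossible
        push Not at hz₂
        have := posMeasure_eq_of_forall_pos hz₂
        have : (2 * π : ℝ) < 1 := by linarith
        nlinarith [Real.pi_gt_three]
  -- growth bounds for `V'`
  set K₀ : ℝ := 4 * π * (Real.log A ^ 2 + B ^ 2) + 1 with hK₀
  have hK₀pos : 0 < K₀ := by positivity
  have hb : ∀ {ξ : ℂ → ℂ}, Differentiable ℂ ξ → (∀ z, ‖ξ z‖ ≤ A * Real.exp (B * √‖z‖)) →
      ∀ s, s₁ ≤ s → sqInt' (liftExp ξ) s ≤ K₀ * Real.exp 1 * Real.exp s := by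
    intro ξ hξ hg s hs
    have hΞ := differentiable_liftExp hξ
    have hmono : Monotone (sqInt' (liftExp ξ)) :=
      monotone_of_deriv2_nonneg (hasDerivAt_sqInt' hΞ) (sqInt''_nonneg hξ)
    have h1 := deriv_le_sub_of_convex (hasDerivAt_sqInt hΞ) hmono s
    have h2 := sqInt_liftExp_le_exp hξ hA hB hg (s := s + 1) (by linarith)
    have h3 := sqInt_nonneg' (liftExp ξ) s
    rw [Real.exp_add] at h2
    nlinarith [Real.exp_pos s, Real.exp_pos 1]
  exact false_of_rates hηpos (by positivity : 0 < K₀ * Real.exp 1) (hasDerivAt_sqInt' hΞ₁)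
    (hasDerivAt_sqInt' hΞ₂) hV'₁ hV'₂ hrate (hb h₁ hg₁) (hb h₂ hg₂)

/-- **de Branges' lemma (dichotomy for entire functions of order `< 1` small off the real axis).**
Let `ξ₁, ξ₂` be entire functions with `|ξⱼ(z)| ≤ A e^{B √|z|}` and
`min(|ξ₁(z)|, |ξ₂(z)|) ≤ 1/|Im z|` off the real axis. Then `ξ₁ ≡ 0` or `ξ₂ ≡ 0`.
This is the case of growth order `≤ 1/2` of Romanov's Proposition 26 ("Let `ξ₁, ξ₂` be entire
functions of exponential type of minimal type such that `min{|ξ₁(z)|, |ξ₂(z)|} ≤ c/|z|` (the proof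
uses `c/|Im z|`). Then one of them is zero identically."), the analytic heart of the proof of the
ordering theorem for de Branges subspaces (Romanov Thm. 12; de Branges 1968, Thm. 35).
-- TODO(general form): minimal exponential type instead of order `1/2` (needs the sharp Carleman
-- constant `π²` in the Poincaré step).
[cite: Romanov2014, App. III Proposition 26] -/
theorem eq_zero_or_eq_zero_of_min_norm_le {ξ₁ ξ₂ : ℂ → ℂ} (h₁ : Differentiable ℂ ξ₁)
    (h₂ : Differentiable ℂ ξ₂) {A B : ℝ} (hg₁ : ∀ z, ‖ξ₁ z‖ ≤ A * Real.exp (B * √‖z‖))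
    (hg₂ : ∀ z, ‖ξ₂ z‖ ≤ A * Real.exp (B * √‖z‖))
    (hmin : ∀ z : ℂ, z.im ≠ 0 → min ‖ξ₁ z‖ ‖ξ₂ z‖ ≤ |z.im|⁻¹) : ξ₁ = 0 ∨ ξ₂ = 0 := by
  -- normalise the constants
  set A' : ℝ := max A 1 with hA'
  set B' : ℝ := max B 0 with hB'
  have hA1 : 1 ≤ A' := le_max_right _ _
  have hB0 : 0 ≤ B' := le_max_right _ _
  have hg' : ∀ {ξ : ℂ → ℂ}, (∀ z, ‖ξ z‖ ≤ A * Real.exp (B * √‖z‖)) →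
      ∀ z, ‖ξ z‖ ≤ A' * Real.exp (B' * √‖z‖) := by
    intro ξ hg z
    calc ‖ξ z‖ ≤ A * Real.exp (B * √‖z‖) := hg z
      _ ≤ A' * Real.exp (B * √‖z‖) := mul_le_mul_of_nonneg_right (le_max_left _ _) (Real.exp_pos _).le
      _ ≤ A' * Real.exp (B' * √‖z‖) :=
          mul_le_mul_of_nonneg_left (Real.exp_le_exp.2
            (mul_le_mul_of_nonneg_right (le_max_left _ _) (Real.sqrt_nonneg _))) (by linarith)
  have hg₁' := hg' hg₁
  have hg₂' := hg' hg₂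
  by_cases hc₁ : ∀ z, ξ₁ z = ξ₁ 0
  · by_cases h0 : ξ₁ 0 = 0
    · left; funext z; rw [hc₁ z, h0]; rfl
    · right
      refine eq_zero_of_const h₂ h0 hB0 hg₂' fun z hz => ?_
      rw [← hc₁ z]; exact hmin z hz
  · push Not at hc₁
    by_cases hc₂ : ∀ z, ξ₂ z = ξ₂ 0
    · by_cases h0 : ξ₂ 0 = 0
      · right; funext z; rw [hc₂ z, h0]; rfl
      · left
        refine eq_zero_of_const h₁ h0 hB0 hg₁' fun z hz => ?_
        rw [← hc₂ z, min_comm]; exact hmin z hz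
    · push Not at hc₂
      exact (false_of_nonconst h₁ h₂ hA1 hB0 hg₁' hg₂' hmin hc₁ hc₂).elim

end Main

end CarlemanTract

end Literature.Analysis.Complex
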